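import Summits.MatrixMultiplication.MatrixMultiplication.Theses.SnSubsetDichotomy
import Summits.MatrixMultiplication.MatrixMultiplication.Theorems.SnSubsetDichotomyVershikKerovBound
import Literature.Barriers.MatrixMultiplication.YoungSubgroupBarrier

/-!
# Disproof of `GlobalBranch` — findings (cdisprove, crux `stmt-MatrixMultiplication-8303`)

(v5, cycle 2 — rebuilt: the cycle-1 file (v4, 1966 lines, evidence `20260815T230354Z-Disproof.lean`)
is not mounted on the hub jails, so its content is re-derived here and PUBLISHED as the crux
workfile `Cruxes/GlobalBranch/Disproof.lean`; conclusive parts are landed under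
`Theorems/GlobalBranch/Negative/`.)

The crux (`SnSubsetDichotomy.GlobalBranch`, rank 2 of route `SnSubsetDichotomy`):
`∃ ε > 0, ∃ c > 0, ∃ n₀, ∀ n ≥ n₀`, every TPP triple `(S,T,U)` in `S_n` all of whose three sets are
`(1/2+ε)`-bump-free up to level `√n` (`|X ∩ U_{I→L}|·n^(t) ≤ n^{(1/2+ε)t}|X|`) has
`|S||T||U| ≤ (n!)^{3/2} e^{-c√n}`.

## Findings (section → declaration)

* §1 RESISTANCE — `thresholdSubsetTriples_of_not_globalBranch`,
  `matrixMultiplication_of_not_globalBranch`: `¬GlobalBranch → ThresholdSubsetTriples → ω(ℂ) = 2`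
  (forget the bump hypothesis; `closes` + the proved `vershikKerovBound_proof`).  Hence NO CHEAP
  KILL EXISTS: an unconditional refutation of the crux is a proof of the summit.  Dually
  `globalBranch_of_noThresholdSubsetTriple`: the negative side `¬X` implies the crux outright.
* §2 CALIBRATION — `bumpFree_of_one_le` (exponent `κ ≥ 1`, i.e. `ε ≥ 1/2`: every set is
  bump-free, the hypothesis is void), `globalBranchAt_iff_of_half_le` (for `ε ≥ 1/2` the crux at
  `(ε,c,n₀)` IS the no-threshold statement at `(c,n₀)`), `globalBranchAt_anti` (antitone in `ε`),
  `globalBranch_iff_small_eps` (content only for `0 < ε < 1/2`).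
* §3 LOAD-BEARING HYPOTHESES — `card_univ_umvirate_mul_descFactorial` (exact umvirate count
  `|U_{I→L}|·n^(t) = n!`), `univ_bumpFree` (`S_n` itself is bump-free at every exponent `κ ≥ 0`),
  `globalBranch_false_without_TPP` (drop the TPP: `S = T = U = S_n` has volume `(n!)^3`);
  `not_bumpFree_of_nonInjective_allowed` / `globalBranchWithoutInjectivity_trivial` (drop the
  injectivity of the source tuple `I`: the hypothesis becomes unsatisfiable for non-empty sets by
  pigeonhole, so the statement turns vacuously TRUE — injectivity is what keeps the class inhabited).
* §4 THE HYPOTHESIS CLASS — `descFactorial_le_of_bumpFree` (a non-empty `κ`-bump-free set has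
  `|X|·n^{κt} ≥ n^(t)` at every admissible level: bump-free sets are automatically large, the crux
  never sees small sets), `bumpFree_mono` (larger exponent, weaker condition).
* §5 NATURAL STRENGTHENING REFUTED — `not_globalBranchSuperExp` (re-proved this cycle; also landed
  as `Theorems/GlobalBranch/Negative/SuperExp.lean`): the strengthened conclusion `(n!)^{3/2}e^{-Cn}`
  for EVERY `C` is FALSE, and so is the weaker ALL-LEVELS form (`not_globalBranchSuperExpAllLevels`,
  bump hypothesis imposed at every `1 ≤ t ≤ n`).  Witness family = BCCGU17 hexagon Young triples:
  `planar_core`/`hexYoung_tpp` (ANY finite planar configuration gives a TPP triple of Young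
  subgroups — quadratic identity `Σ d² = 0` for `d = a∘σ₂ − a`), `young_bump`
  (`|Y ∩ U_{I→L}|·(s/e)^t ≤ |Y|` when all blocks `≥ s`; exact refined-Young count +
  `(b/e)^r ≤ b^(r)`), `young_volume` (`(s/e)^n ≤ |Y|`), `HexPt R` (lines `≥ R+1`, `≤ (2R+1)²`
  points), `hexYoung_bump` (bump-free at exponent `1/2+ε` at EVERY level once `n^ε ≥ 2e`),
  `hexYoung_volume` (`> (n!)^{3/2}e^{-7n}`).  So the saving for bump-free TPP triples is at most
  `e^{-O(n)}`; `e^{-cn} ∃c` is OPEN (true for Young triples, `BCCGU2017_thm42_holds`; refuting it =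
  beating Young subgroups, the frontier); `e^{-C√n} ∀C` OPEN; the crux's `e^{-c√n} ∃c` untouched.
* §6 SECOND NATURAL STRENGTHENING REFUTED — `not_pairwiseGlobalBranch` (re-proved this cycle with
  a SIMPLER witness; in `Negative/HexagonWitnesses.lean`): the two-set version (`s s'⁻¹ t t'⁻¹ = 1 ⇒
  s = s', t = t'`, both sets bump-free `⇒ |S||T| ≤ n!·e^{-c√n}`) is FALSE: `(Y, T)` = hexagon Young
  subgroup + ANY right transversal of it (`transversal f`: one permutation per realised labelling
  `f ∘ g`) has the two-set relation (`young_transversal_pairwise`), `|Y||T| = n!` exactly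
  (`card_transversal_mul_card_young`), and `T` is bump-free with ratio `≤ ∏ₖ b_{f(L k)} ≤ (2R+1)^t`
  (`transversal_bump` — no sortedness needed, only the block structure of the targets).  The two-set
  version implies the crux (`not_pairwiseGlobalBranch_of_not_globalBranch`), so: packing/two-set
  arguments give NO saving for bump-free sets; the whole `e^{-c√n}` must come from the genuinely
  3-wise relation.
* REGIME NOTES for provers (paper, cycle 1 §7b + triage r1): the crux's bump-freeness is
  KL-globalness with `r = n^{1/4+ε/2}` at density `(n!)^{-1/2}`; Keevash–Lifshitz (arXiv:2307.15030)
  Thm 1.8/1.9 need `C r⁴ log(1/μ) < n` — void here by a factor `n^{1+2ε} log n`, ALSO on the quotient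
  sets `S⁻¹T` (density `e^{-(2c/3)√n}`, `r⁴ log(1/μ) ≈ n^{1+2ε}√n`); Kedlaya sets are product-free at
  density `e^{-K√n}` with bumps `≤ n^{1/4}`: globalness of the dense quotient sets alone forces no
  mixing.  Blind spots of the HYPOTHESIS (triage r1, confirmed): setwise-stabiliser cosets
  `{u : u(B) = L}` with `|B| ≈ c√n/log n` (ratio `(√n log n)^t`), giant two-block Young hosts
  `S_{n/2} × S_{n/2}` (ratio `≈ 2^t`), thick half-block Bohr sets, and `B_m = S_2 ≀ S_m` (ratio
  `(n-1)(n-3)⋯ < n^{t/2}`, bump-free even at `ε = 0`) all satisfy the hypothesis: a proof must kill them.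
-/

noncomputable section

set_option linter.dupNamespace false

open scoped BigOperators

namespace Summit.MatrixMultiplication.MatrixMultiplication.Cruxes.GlobalBranch.Disproof

open Summit.MatrixMultiplication.MatrixMultiplication.Theses.SnSubsetDichotomy
open Literature.Combinatorics.Additive Literature.Barriers.MatrixMultiplication
open Equiv

set_option linter.unusedSectionVars false

/-! ## §0 Definitions: bump-freeness and the crux at fixed parameters -/

/-- `κ`-bump-freeness of a set `X ⊆ S_n` up to level `√n` (the crux uses `κ = 1/2 + ε`):
`|X ∩ U_{I→L}|·n^(t) ≤ n^{κ t}·|X|` for `1 ≤ t ≤ √n` and injective `I, L : Fin t → Fin n`, where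
`U_{I→L} = {σ : σ ∘ I = L}` is the `t`-umvirate. -/
def BumpFree {n : ℕ} (κ : ℝ) (X : Finset (Equiv.Perm (Fin n))) : Prop :=
  ∀ t : ℕ, 1 ≤ t → (t : ℝ) ≤ Real.sqrt (n : ℝ) → ∀ I L : Fin t → Fin n, Function.Injective I →
    Function.Injective L →
      ((X.filter (fun σ => ∀ k, σ (I k) = L k)).card : ℝ) * (n.descFactorial t : ℝ) ≤
        (n : ℝ) ^ (κ * t) * (X.card : ℝ)

/-- The crux at fixed parameters `(ε, c, n₀)`. -/
def GlobalBranchAt (ε c : ℝ) (n₀ : ℕ) : Prop :=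
  ∀ n ≥ n₀, ∀ S T U : Finset (Equiv.Perm (Fin n)), TripleProductProperty S T U →
    (∀ X : Finset (Equiv.Perm (Fin n)), (X = S ∨ X = T ∨ X = U) → BumpFree (1 / 2 + ε) X) →
      ((S.card * T.card * U.card : ℕ) : ℝ) ≤
        (n.factorial : ℝ) ^ ((3 : ℝ) / 2) * Real.exp (-(c * Real.sqrt (n : ℝ)))

/-- The no-threshold statement at fixed parameters `(c, n₀)` (`NoThresholdSubsetTriple = ∃ c > 0,
∃ n₀, NoThresholdAt c n₀`). -/
def NoThresholdAt (c : ℝ) (n₀ : ℕ) : Prop :=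
  ∀ n ≥ n₀, ∀ S T U : Finset (Equiv.Perm (Fin n)), TripleProductProperty S T U →
    ((S.card * T.card * U.card : ℕ) : ℝ) ≤
      (n.factorial : ℝ) ^ ((3 : ℝ) / 2) * Real.exp (-(c * Real.sqrt (n : ℝ)))

/-- The crux is literally `∃ ε > 0, ∃ c > 0, ∃ n₀, GlobalBranchAt ε c n₀`. -/
theorem globalBranch_iff :
    GlobalBranch ↔ ∃ ε : ℝ, 0 < ε ∧ ∃ c : ℝ, 0 < c ∧ ∃ n₀ : ℕ, GlobalBranchAt ε c n₀ :=
  Iff.rfl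

/-- The negative side is literally `∃ c > 0, ∃ n₀, NoThresholdAt c n₀`. -/
theorem noThresholdSubsetTriple_iff :
    NoThresholdSubsetTriple ↔ ∃ c : ℝ, 0 < c ∧ ∃ n₀ : ℕ, NoThresholdAt c n₀ :=
  Iff.rfl

/-! ## §1 Resistance: refuting the crux proves the summit -/

/-- `NoThresholdAt c n₀ → GlobalBranchAt ε c n₀` for every `ε`: the crux is the no-threshold
statement restricted to bump-free triples. -/
theorem globalBranchAt_of_noThresholdAt {ε c : ℝ} {n₀ : ℕ} (h : NoThresholdAt c n₀) :
    GlobalBranchAt ε c n₀ :=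
  fun n hn S T U hTPP _ => h n hn S T U hTPP

/-- The negative side `¬X = NoThresholdSubsetTriple` implies the crux outright (take `ε := 1`). -/
theorem globalBranch_of_noThresholdSubsetTriple (h : NoThresholdSubsetTriple) : GlobalBranch := by
  obtain ⟨c, hc, n₀, h⟩ := h
  exact ⟨1, one_pos, c, hc, n₀, globalBranchAt_of_noThresholdAt h⟩

/-- **Resistance.** A refutation of the crux yields threshold TPP subset triples (the route's
TARGET): forget the bump hypothesis. -/
theorem thresholdSubsetTriples_of_not_globalBranch (h : ¬ GlobalBranch) :
    ThresholdSubsetTriples := by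
  intro c hc n₀
  by_contra hcon
  refine h ⟨1, one_pos, c, hc, n₀, fun n hn S T U hTPP _ => ?_⟩
  by_contra hlt
  exact hcon ⟨n, hn, S, T, U, hTPP, lt_of_not_ge hlt⟩

/-- **Resistance, summit form.** A refutation of the crux proves `ω(ℂ) = 2`, through the route's
deciding theorem `closes` and the PROVED Vershik–Kerov bound. So no cheap kill of the crux exists:
every unconditional `¬GlobalBranch` is a proof of the summit. -/
theorem matrixMultiplication_of_not_globalBranch (h : ¬ GlobalBranch) : MatrixMultiplication :=
  closes (thresholdSubsetTriples_of_not_globalBranch h) Theorems.vershikKerovBound_proof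

/-- Contrapositive bookkeeping: the crux fails iff bump-free threshold triples exist at every scale. -/
theorem not_globalBranch_iff :
    ¬ GlobalBranch ↔ ∀ ε : ℝ, 0 < ε → ∀ c : ℝ, 0 < c → ∀ n₀ : ℕ, ∃ n ≥ n₀,
      ∃ S T U : Finset (Equiv.Perm (Fin n)), TripleProductProperty S T U ∧
        (∀ X : Finset (Equiv.Perm (Fin n)), (X = S ∨ X = T ∨ X = U) → BumpFree (1 / 2 + ε) X) ∧
        (n.factorial : ℝ) ^ ((3 : ℝ) / 2) * Real.exp (-(c * Real.sqrt (n : ℝ))) <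
          ((S.card * T.card * U.card : ℕ) : ℝ) := by
  rw [globalBranch_iff]
  simp only [GlobalBranchAt, not_exists, not_and, not_forall, not_le, exists_prop]

/-! ## §2 Calibration in `ε` -/

/-- An admissible level `1 ≤ t ≤ √n` forces `0 < n`. -/
theorem pos_of_level {n t : ℕ} (ht : 1 ≤ t) (hts : (t : ℝ) ≤ Real.sqrt (n : ℝ)) : 0 < n := by
  rcases Nat.eq_zero_or_pos n with rfl | hn
  · exfalso
    have h1 : (1 : ℝ) ≤ Real.sqrt ((0 : ℕ) : ℝ) := le_trans (by exact_mod_cast ht) hts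
    rw [Nat.cast_zero, Real.sqrt_zero] at h1
    exact absurd h1 (by norm_num)
  · exact hn

/-- Bump-freeness is monotone in the exponent (for `n ≥ 1`). -/
theorem bumpFree_mono {n : ℕ} {κ κ' : ℝ} (hκ : κ ≤ κ') {X : Finset (Equiv.Perm (Fin n))}
    (h : BumpFree κ X) : BumpFree κ' X := by
  intro t ht hts I L hI hL
  refine (h t ht hts I L hI hL).trans (mul_le_mul_of_nonneg_right ?_ (Nat.cast_nonneg _))
  have hn : 0 < n := pos_of_level ht hts
  exact Real.rpow_le_rpow_of_exponent_le (by exact_mod_cast hn)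
    (mul_le_mul_of_nonneg_right hκ (Nat.cast_nonneg _))

/-- For exponent `κ ≥ 1` (i.e. `ε ≥ 1/2`) EVERY set is bump-free: `|X ∩ U|·n^(t) ≤ |X|·n^t`. -/
theorem bumpFree_of_one_le {n : ℕ} {κ : ℝ} (hκ : 1 ≤ κ) (X : Finset (Equiv.Perm (Fin n))) :
    BumpFree κ X := by
  intro t ht hts I L _ _
  have hn : 0 < n := pos_of_level ht hts
  have h1 : ((X.filter (fun σ => ∀ k, σ (I k) = L k)).card : ℝ) ≤ X.card := by
    exact_mod_cast Finset.card_filter_le _ _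
  have h2 : (n.descFactorial t : ℝ) ≤ (n : ℝ) ^ (κ * t) := by
    calc (n.descFactorial t : ℝ) ≤ ((n ^ t : ℕ) : ℝ) := by
            exact_mod_cast Nat.descFactorial_le_pow n t
      _ = (n : ℝ) ^ ((t : ℕ) : ℝ) := by rw [Nat.cast_pow, Real.rpow_natCast]
      _ ≤ (n : ℝ) ^ (κ * t) := by
            refine Real.rpow_le_rpow_of_exponent_le (by exact_mod_cast hn) ?_
            calc ((t : ℕ) : ℝ) = 1 * t := (one_mul _).symm
              _ ≤ κ * t := mul_le_mul_of_nonneg_right hκ (Nat.cast_nonneg _)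
  calc ((X.filter (fun σ => ∀ k, σ (I k) = L k)).card : ℝ) * (n.descFactorial t : ℝ)
      ≤ (X.card : ℝ) * (n : ℝ) ^ (κ * t) :=
        mul_le_mul h1 h2 (Nat.cast_nonneg _) (Nat.cast_nonneg _)
    _ = (n : ℝ) ^ (κ * t) * (X.card : ℝ) := mul_comm _ _

/-- For `ε ≥ 1/2` the crux at `(ε, c, n₀)` IS the no-threshold statement at `(c, n₀)`: the bump
hypothesis is void there. -/
theorem globalBranchAt_iff_of_half_le {ε c : ℝ} {n₀ : ℕ} (hε : 1 / 2 ≤ ε) :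
    GlobalBranchAt ε c n₀ ↔ NoThresholdAt c n₀ := by
  refine ⟨fun h n hn S T U hTPP => h n hn S T U hTPP fun X _ => ?_, globalBranchAt_of_noThresholdAt⟩
  exact bumpFree_of_one_le (by linarith) X

/-- The crux is antitone in `ε`: larger `ε` admits more triples, so the statement gets stronger. -/
theorem globalBranchAt_anti {ε ε' c : ℝ} {n₀ : ℕ} (hε : ε ≤ ε') (h : GlobalBranchAt ε' c n₀) :
    GlobalBranchAt ε c n₀ :=
  fun n hn S T U hTPP hB => h n hn S T U hTPP fun X hX => bumpFree_mono (by linarith) (hB X hX)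

/-- Only `0 < ε < 1/2` carries content: at `ε ≥ 1/2` the crux is `¬X` itself, and a witness `ε`
can always be shrunk. -/
theorem globalBranch_iff_small_eps :
    GlobalBranch ↔ ∃ ε : ℝ, 0 < ε ∧ ε < 1 / 2 ∧ ∃ c : ℝ, 0 < c ∧ ∃ n₀ : ℕ, GlobalBranchAt ε c n₀ := by
  rw [globalBranch_iff]
  constructor
  · rintro ⟨ε, hε, c, hc, n₀, h⟩
    refine ⟨min ε (1 / 4), lt_min hε (by norm_num), ?_, c, hc, n₀, ?_⟩
    · exact (min_le_right _ _).trans_lt (by norm_num)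
    · exact globalBranchAt_anti (min_le_left _ _) h
  · rintro ⟨ε, hε, -, c, hc, n₀, h⟩
    exact ⟨ε, hε, c, hc, n₀, h⟩

/-! ## §3 Load-bearing hypotheses -/

section Umvirate

variable {n t : ℕ}

/-- Left translation carries one umvirate with source `I` onto another. -/
theorem card_univ_umvirate_eq (I : Fin t → Fin n) {L L' : Fin t → Fin n}
    (hL : Function.Injective L) (hL' : Function.Injective L') :
    ((Finset.univ : Finset (Equiv.Perm (Fin n))).filter (fun σ => ∀ k, σ (I k) = L k)).card =
      ((Finset.univ : Finset (Equiv.Perm (Fin n))).filter (fun σ => ∀ k, σ (I k) = L' k)).card := by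
  obtain ⟨π, hπ⟩ := Equiv.Perm.exists_extending_pair L L' hL hL'
  refine Finset.card_nbij' (fun σ => π * σ) (fun σ => π⁻¹ * σ) ?_ ?_ ?_ ?_
  · intro σ hσ
    simp only [Finset.mem_coe, Finset.mem_filter, Finset.mem_univ, true_and] at hσ ⊢
    intro k
    rw [Equiv.Perm.mul_apply, hσ k, hπ k]
  · intro σ hσ
    simp only [Finset.mem_coe, Finset.mem_filter, Finset.mem_univ, true_and] at hσ ⊢
    intro k
    rw [Equiv.Perm.mul_apply, hσ k, ← hπ k]
    simp
  · intro σ _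
    simp [← mul_assoc]
  · intro σ _
    simp [← mul_assoc]

/-- The umvirates with a fixed injective source `I` partition `S_n` into `n^(t)` classes. -/
theorem sum_card_univ_umvirate (I : Fin t → Fin n) (hI : Function.Injective I) :
    ∑ L : Fin t ↪ Fin n,
        ((Finset.univ : Finset (Equiv.Perm (Fin n))).filter (fun σ => ∀ k, σ (I k) = L k)).card =
      n.factorial := by
  classical
  have h := Finset.card_eq_sum_card_fiberwise
    (f := fun σ : Equiv.Perm (Fin n) => (⟨σ ∘ I, σ.injective.comp hI⟩ : Fin t ↪ Fin n))
    (s := Finset.univ) (t := Finset.univ) (fun _ _ => Finset.mem_univ _)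
  rw [Finset.card_univ, Fintype.card_perm, Fintype.card_fin] at h
  rw [h]
  refine Finset.sum_congr rfl fun L _ => ?_
  congr 1
  ext σ
  simp only [Finset.mem_filter, Finset.mem_univ, true_and]
  constructor
  · intro hσ
    exact Function.Embedding.ext fun k => by simpa using hσ k
  · intro hσ k
    have := congrArg (fun e : Fin t ↪ Fin n => e k) hσ
    simpa using this

/-- **Exact umvirate count in `S_n`:** `|U_{I→L}| · n^(t) = n!` for injective `I, L`. -/
theorem card_univ_umvirate_mul_descFactorial (I L : Fin t → Fin n) (hI : Function.Injective I)
    (hL : Function.Injective L) :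
    ((Finset.univ : Finset (Equiv.Perm (Fin n))).filter (fun σ => ∀ k, σ (I k) = L k)).card *
        n.descFactorial t = n.factorial := by
  classical
  have hsum := sum_card_univ_umvirate I hI
  have hconst : ∀ L' : Fin t ↪ Fin n,
      ((Finset.univ : Finset (Equiv.Perm (Fin n))).filter (fun σ => ∀ k, σ (I k) = L' k)).card =
        ((Finset.univ : Finset (Equiv.Perm (Fin n))).filter (fun σ => ∀ k, σ (I k) = L k)).card :=
    fun L' => card_univ_umvirate_eq I L'.injective hL
  rw [Finset.sum_congr rfl (fun L' _ => hconst L'), Finset.sum_const, Finset.card_univ,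
    Fintype.card_embedding_eq, Fintype.card_fin, Fintype.card_fin, smul_eq_mul, mul_comm] at hsum
  exact hsum

/-- **`S_n` itself is bump-free at every exponent `κ ≥ 0`** (its umvirate ratios are all exactly
`1`). In particular the triple `(S_n, S_n, S_n)` satisfies the bump hypothesis of the crux. -/
theorem univ_bumpFree {κ : ℝ} (hκ : 0 ≤ κ) :
    BumpFree κ (Finset.univ : Finset (Equiv.Perm (Fin n))) := by
  intro t ht hts I L hI hL
  have hn : 0 < n := pos_of_level ht hts
  have h := card_univ_umvirate_mul_descFactorial I L hI hL
  have h' : (((Finset.univ : Finset (Equiv.Perm (Fin n))).filter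
      (fun σ => ∀ k, σ (I k) = L k)).card : ℝ) * (n.descFactorial t : ℝ) = n.factorial := by
    exact_mod_cast h
  rw [h', Finset.card_univ, Fintype.card_perm, Fintype.card_fin]
  have h1 : (1 : ℝ) ≤ (n : ℝ) ^ (κ * t) :=
    Real.one_le_rpow (by exact_mod_cast hn) (mul_nonneg hκ (Nat.cast_nonneg _))
  calc (n.factorial : ℝ) = 1 * n.factorial := (one_mul _).symm
    _ ≤ (n : ℝ) ^ (κ * t) * n.factorial :=
        mul_le_mul_of_nonneg_right h1 (Nat.cast_nonneg _)

end Umvirate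

/-- The crux with the triple product property DROPPED. -/
def GlobalBranchWithoutTPP : Prop :=
  ∃ ε : ℝ, 0 < ε ∧ ∃ c : ℝ, 0 < c ∧ ∃ n₀ : ℕ, ∀ n ≥ n₀, ∀ S T U : Finset (Equiv.Perm (Fin n)),
    (∀ X : Finset (Equiv.Perm (Fin n)), (X = S ∨ X = T ∨ X = U) → BumpFree (1 / 2 + ε) X) →
      ((S.card * T.card * U.card : ℕ) : ℝ) ≤
        (n.factorial : ℝ) ^ ((3 : ℝ) / 2) * Real.exp (-(c * Real.sqrt (n : ℝ)))

/-- **The TPP is load-bearing:** without it the statement is false — `S = T = U = S_n` is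
bump-free at every scale and has volume `(n!)^3 > (n!)^{3/2} e^{-c√n}` (`n ≥ 2`). Any proof must
use the triple product property (and, by cycle 1's `not_pairwiseGlobalBranch`, more than its
pairwise part). -/
theorem globalBranch_false_without_TPP : ¬ GlobalBranchWithoutTPP := by
  rintro ⟨ε, hε, c, hc, n₀, h⟩
  -- take `n := max n₀ 2` and the triple `(S_n, S_n, S_n)`
  set n := max n₀ 2 with hn
  have hn₀ : n ≥ n₀ := le_max_left _ _
  have hn2 : 2 ≤ n := le_max_right _ _
  have hB : ∀ X : Finset (Equiv.Perm (Fin n)),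
      (X = Finset.univ ∨ X = Finset.univ ∨ X = Finset.univ) → BumpFree (1 / 2 + ε) X := by
    rintro X (rfl | rfl | rfl) <;> exact univ_bumpFree (by linarith)
  have key := h n hn₀ Finset.univ Finset.univ Finset.univ hB
  rw [Finset.card_univ, Fintype.card_perm, Fintype.card_fin] at key
  -- `(n!)^3 ≤ (n!)^{3/2} e^{-c√n} < (n!)^{3/2} ≤ (n!)^3`: contradiction
  have hf1 : (1 : ℝ) < n.factorial := by
    have : 2 ≤ n.factorial := (Nat.factorial_le hn2).trans' (by decide)
    exact_mod_cast this
  have hf0 : (0 : ℝ) < n.factorial := by linarith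
  have hexp : Real.exp (-(c * Real.sqrt (n : ℝ))) < 1 := by
    rw [Real.exp_lt_one_iff]
    have : 0 < Real.sqrt (n : ℝ) := Real.sqrt_pos.2 (by exact_mod_cast (by omega : 0 < n))
    nlinarith
  have h32 : (n.factorial : ℝ) ^ ((3 : ℝ) / 2) ≤ (n.factorial : ℝ) ^ (3 : ℝ) :=
    Real.rpow_le_rpow_of_exponent_le hf1.le (by norm_num)
  have h3 : (n.factorial : ℝ) ^ (3 : ℝ) = ((n.factorial * n.factorial * n.factorial : ℕ) : ℝ) := by
    rw [show (3 : ℝ) = ((3 : ℕ) : ℝ) by norm_num, Real.rpow_natCast]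
    push_cast
    ring
  have hpos : (0 : ℝ) < (n.factorial : ℝ) ^ ((3 : ℝ) / 2) := Real.rpow_pos_of_pos hf0 _
  have : (n.factorial : ℝ) ^ ((3 : ℝ) / 2) * Real.exp (-(c * Real.sqrt (n : ℝ))) <
      (n.factorial : ℝ) ^ ((3 : ℝ) / 2) * 1 := mul_lt_mul_of_pos_left hexp hpos
  rw [mul_one] at this
  rw [← h3] at key
  linarith

/-! ### Injectivity of the source tuple keeps the hypothesis class inhabited

With a NON-injective source `I` allowed, the "umvirate" `{σ : σ ∘ I = L}` for `I ≡ i₀`, `L ≡ l₀`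
is the point fibre `{σ : σ i₀ = l₀}` while the normalisation `n^(t)` still grows with `t`: at
`t = 5`, `ε = 1/10` the condition asks `|X ∩ {σ i₀ = l₀}|·n^(5) ≤ n^3 |X|` for ALL `l₀`, impossible
for `X ≠ ∅` by pigeonhole over `l₀` once `n^(5) > n^4`. So that variant of the crux holds
VACUOUSLY (`ε := 1/10`, `n ≥ 25`): the injectivity requirement is what makes the statement
contentful. -/

/-- Bump-freeness with the injectivity requirements on `I, L` dropped. -/
def BumpFreeNonInj {n : ℕ} (κ : ℝ) (X : Finset (Equiv.Perm (Fin n))) : Prop :=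
  ∀ t : ℕ, 1 ≤ t → (t : ℝ) ≤ Real.sqrt (n : ℝ) → ∀ I L : Fin t → Fin n,
    ((X.filter (fun σ => ∀ k, σ (I k) = L k)).card : ℝ) * (n.descFactorial t : ℝ) ≤
      (n : ℝ) ^ (κ * t) * (X.card : ℝ)

/-- The crux with the injectivity of `I, L` dropped from the bump hypothesis. -/
def GlobalBranchWithoutInjectivity : Prop :=
  ∃ ε : ℝ, 0 < ε ∧ ∃ c : ℝ, 0 < c ∧ ∃ n₀ : ℕ, ∀ n ≥ n₀, ∀ S T U : Finset (Equiv.Perm (Fin n)),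
    TripleProductProperty S T U →
    (∀ X : Finset (Equiv.Perm (Fin n)), (X = S ∨ X = T ∨ X = U) → BumpFreeNonInj (1 / 2 + ε) X) →
      ((S.card * T.card * U.card : ℕ) : ℝ) ≤
        (n.factorial : ℝ) ^ ((3 : ℝ) / 2) * Real.exp (-(c * Real.sqrt (n : ℝ)))

/-- Pigeonhole on the point fibres: some value `l₀` of `σ i₀` is taken by at least `|X|/n`
elements of `X`. -/
theorem exists_fibre_ge {n : ℕ} (X : Finset (Equiv.Perm (Fin n))) (i₀ : Fin n) :
    ∃ l₀ : Fin n, (X.card : ℝ) ≤ n * ((X.filter (fun σ => σ i₀ = l₀)).card : ℝ) := by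
  classical
  by_contra hcon
  push Not at hcon
  have hsum : ∑ l₀ : Fin n, ((X.filter (fun σ => σ i₀ = l₀)).card : ℝ) = X.card := by
    have h := Finset.card_eq_sum_card_fiberwise (f := fun σ : Equiv.Perm (Fin n) => σ i₀)
      (s := X) (t := Finset.univ) (fun _ _ => Finset.mem_univ _)
    rw [h]
    push_cast
    rfl
  have hlt : ∑ l₀ : Fin n, (n : ℝ) * ((X.filter (fun σ => σ i₀ = l₀)).card : ℝ) <
      ∑ _l₀ : Fin n, (X.card : ℝ) :=
    Finset.sum_lt_sum_of_nonempty ⟨i₀, Finset.mem_univ _⟩ fun l₀ _ => hcon l₀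
  rw [← Finset.mul_sum, hsum, Finset.sum_const, Finset.card_univ, Fintype.card_fin,
    nsmul_eq_mul] at hlt
  exact lt_irrefl _ hlt

/-- With non-injective sources allowed, NO non-empty set is `(1/2 + 1/10)`-bump-free once
`n ≥ 25` (level `t = 5`, constant tuples). -/
theorem not_bumpFreeNonInj {n : ℕ} (hn : 25 ≤ n) {X : Finset (Equiv.Perm (Fin n))}
    (hX : X.Nonempty) : ¬ BumpFreeNonInj (1 / 2 + 1 / 10) X := by
  intro h
  have hn0 : 0 < n := by omega
  obtain ⟨σ₀, hσ₀⟩ := hX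
  set i₀ : Fin n := ⟨0, hn0⟩
  obtain ⟨l₀, hl₀⟩ := exists_fibre_ge X i₀
  have h5 : ((5 : ℕ) : ℝ) ≤ Real.sqrt (n : ℝ) := by
    rw [show ((5 : ℕ) : ℝ) = Real.sqrt 25 by
      rw [show (25 : ℝ) = 5 ^ 2 by norm_num, Real.sqrt_sq (by norm_num)]; norm_num]
    exact Real.sqrt_le_sqrt (by exact_mod_cast hn)
  have key := h 5 (by norm_num) h5 (fun _ => i₀) (fun _ => l₀)
  have hfilter : (X.filter (fun σ => ∀ _k : Fin 5, σ i₀ = l₀)) = X.filter (fun σ => σ i₀ = l₀) := by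
    ext σ; simp
  rw [hfilter] at key
  -- `n^(5) ≥ (n-4)^5` and `n^{(1/2+1/10)·5} = n^3`; with `|X| ≤ n |X ∩ fibre|` this forces
  -- `(n-4)^5 ≤ n^4`, false for `n ≥ 25`.
  have hexp : (n : ℝ) ^ ((1 / 2 + 1 / 10 : ℝ) * ((5 : ℕ) : ℝ)) = (n : ℝ) ^ (3 : ℕ) := by
    rw [← Real.rpow_natCast]
    norm_num
  rw [hexp] at key
  have hdesc : ((n - 4) ^ 5 : ℕ) ≤ n.descFactorial 5 := Nat.pow_sub_le_descFactorial n 5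
  have hdesc' : (((n - 4) ^ 5 : ℕ) : ℝ) ≤ (n.descFactorial 5 : ℝ) := by exact_mod_cast hdesc
  set F : ℝ := ((X.filter (fun σ => σ i₀ = l₀)).card : ℝ) with hF
  have hF0 : 0 < F := by
    have hXc : (0 : ℝ) < X.card := by exact_mod_cast Finset.card_pos.2 ⟨σ₀, hσ₀⟩
    have := hl₀
    by_contra hle
    push Not at hle
    have hF0' : F = 0 := le_antisymm hle (Nat.cast_nonneg _)
    rw [hF0'] at this
    linarith
  have h1 : F * (((n - 4) ^ 5 : ℕ) : ℝ) ≤ (n : ℝ) ^ 3 * (n * F) :=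
    calc F * (((n - 4) ^ 5 : ℕ) : ℝ) ≤ F * (n.descFactorial 5 : ℝ) :=
          mul_le_mul_of_nonneg_left hdesc' hF0.le
      _ ≤ (n : ℝ) ^ 3 * (X.card : ℝ) := key
      _ ≤ (n : ℝ) ^ 3 * (n * F) := mul_le_mul_of_nonneg_left hl₀ (by positivity)
  have h2 : (((n - 4) ^ 5 : ℕ) : ℝ) ≤ (n : ℝ) ^ 4 := by
    have := h1
    rw [show (n : ℝ) ^ 3 * (n * F) = F * (n : ℝ) ^ 4 by ring] at this
    exact le_of_mul_le_mul_left this hF0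
  have h3 : (n : ℕ) ^ 4 < (n - 4) ^ 5 := by
    have h4 : 4 ≤ n := by omega
    -- `(n-4)^5 > n^4` for `n ≥ 25`: set `m = n - 4 ≥ 21`, then `m^5 ≥ 21 m^4 > (m+4)^4`
    obtain ⟨m, rfl⟩ : ∃ m, n = m + 4 := ⟨n - 4, by omega⟩
    have hm : 21 ≤ m := by omega
    simp only [Nat.add_sub_cancel]
    nlinarith [pow_pos (by omega : 0 < m) 2, pow_pos (by omega : 0 < m) 3,
      pow_pos (by omega : 0 < m) 4, hm]
  have h3' : ((n : ℕ) : ℝ) ^ 4 < (((n - 4) ^ 5 : ℕ) : ℝ) := by exact_mod_cast h3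
  linarith

/-- **Dropping injectivity makes the crux vacuously true** (`ε := 1/10`, any `c`, `n₀ := 25`):
the modified hypothesis forces `S = ∅` (indeed all three sets empty), so the volume is `0`. -/
theorem globalBranchWithoutInjectivity_trivial : GlobalBranchWithoutInjectivity := by
  refine ⟨1 / 10, by norm_num, 1, one_pos, 25, fun n hn S T U _ hB => ?_⟩
  have hS : S = ∅ := by
    by_contra hne
    exact not_bumpFreeNonInj hn (Finset.nonempty_iff_ne_empty.2 hne) (hB S (Or.inl rfl))
  subst hS
  simp only [Finset.card_empty, zero_mul, Nat.cast_zero]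
  positivity

/-! ## §4 The hypothesis class: bump-free sets are large -/

/-- A non-empty `κ`-bump-free set satisfies `n^(t) ≤ n^{κ t}·|X|` at every admissible level `t`
(apply the hypothesis to `I := σ₀⁻¹ ∘ L`-type data: the umvirate through any element of `X` is
non-empty). In the crux (`κ = 1/2 + ε`, `t = ⌊√n⌋`) this reads `|X| ≥ n^{(1/2-ε)√n (1+o(1))}`:
the statement never sees small sets. -/
theorem descFactorial_le_of_bumpFree {n : ℕ} {κ : ℝ} {X : Finset (Equiv.Perm (Fin n))}
    (h : BumpFree κ X) (hX : X.Nonempty) {t : ℕ} (ht : 1 ≤ t) (hts : (t : ℝ) ≤ Real.sqrt (n : ℝ))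
    (htn : t ≤ n) : (n.descFactorial t : ℝ) ≤ (n : ℝ) ^ (κ * t) * (X.card : ℝ) := by
  obtain ⟨σ₀, hσ₀⟩ := hX
  -- source: the first `t` points; target: their images under `σ₀`
  let I : Fin t → Fin n := fun k => ⟨k, lt_of_lt_of_le k.isLt htn⟩
  have hI : Function.Injective I := fun a b hab => by
    apply Fin.ext
    have := congrArg Fin.val hab
    simpa [I] using this
  let L : Fin t → Fin n := fun k => σ₀ (I k)
  have hL : Function.Injective L := σ₀.injective.comp hI
  have key := h t ht hts I L hI hL
  have hmem : σ₀ ∈ X.filter (fun σ => ∀ k, σ (I k) = L k) := by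
    simp only [Finset.mem_filter]
    exact ⟨hσ₀, fun k => rfl⟩
  have h1 : (1 : ℝ) ≤ ((X.filter (fun σ => ∀ k, σ (I k) = L k)).card : ℝ) := by
    exact_mod_cast Finset.card_pos.2 ⟨σ₀, hmem⟩
  calc (n.descFactorial t : ℝ) = 1 * (n.descFactorial t : ℝ) := (one_mul _).symm
    _ ≤ ((X.filter (fun σ => ∀ k, σ (I k) = L k)).card : ℝ) * (n.descFactorial t : ℝ) :=
        mul_le_mul_of_nonneg_right h1 (Nat.cast_nonneg _)
    _ ≤ (n : ℝ) ^ (κ * t) * (X.card : ℝ) := key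



/-! ## §5–§6 Hexagon witnesses: the super-exponential and the pairwise strengthenings are FALSE -/

/-! ### Part A: the planar identity -/


/-- Core of the planar argument: if `σ₂` preserves `b`, `σ₁` preserves `a`, `σ₁ ∘ σ₂` preserves
`c`, where `a + b + c` is constant and `(a, b)` determines the point, then `σ₂ = 1` and `σ₁ = 1`. -/
theorem planar_core {P : Type*} [Fintype P] (a b c : P → ℤ) (k : ℤ) (hsum : ∀ p, a p + b p + c p = k)
    (hinj : ∀ p q, a p = a q → b p = b q → p = q) (σ₁ σ₂ : Equiv.Perm P)
    (h₁ : ∀ p, a (σ₁ p) = a p) (h₂ : ∀ p, b (σ₂ p) = b p) (h₃ : ∀ p, c (σ₁ (σ₂ p)) = c p) :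
    σ₂ = 1 ∧ σ₁ = 1 := by
  -- `d p := a (σ₂ p) - a p`
  set d : P → ℤ := fun p => a (σ₂ p) - a p with hd
  have hS0 : ∑ p, a (σ₂ p) = ∑ p, a p := Equiv.sum_comp σ₂ a
  have hSd : ∑ p, d p = 0 := by
    simp only [hd, Finset.sum_sub_distrib, hS0, sub_self]
  -- (i) `Σ d·b = 0`
  have hi : ∑ p, d p * b p = 0 := by
    have h := Equiv.sum_comp σ₂ (fun p => a p * b p)
    simp only [h₂] at h
    simp only [hd, sub_mul, Finset.sum_sub_distrib, h, sub_self]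
  -- (ii) `Σ d·c = 0`
  have hii : ∑ p, d p * c p = 0 := by
    have h := Equiv.sum_comp (σ₂.trans σ₁) (fun p => a p * c p)
    simp only [Equiv.trans_apply, h₃, h₁] at h
    simp only [hd, sub_mul, Finset.sum_sub_distrib, h, sub_self]
  -- (iii) `Σ a(σ₂ p)² = Σ a²`
  have hiii : ∑ p, a (σ₂ p) ^ 2 = ∑ p, a p ^ 2 := Equiv.sum_comp σ₂ (fun p => a p ^ 2)
  -- (iv) `Σ d·a = 0` from `a = k - b - c`
  have hiv : ∑ p, d p * a p = 0 := by
    have : ∀ p, d p * a p = k * d p - d p * b p - d p * c p := fun p => by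
      rw [← hsum p]; ring
    simp only [this, Finset.sum_sub_distrib, ← Finset.mul_sum, hSd, hi, hii, mul_zero, sub_self]
  -- hence `Σ d² = 0`
  have hd2 : ∑ p, d p ^ 2 = 0 := by
    have : ∀ p, a (σ₂ p) ^ 2 = a p ^ 2 + 2 * (d p * a p) + d p ^ 2 := fun p => by
      simp only [hd]; ring
    simp only [this, Finset.sum_add_distrib, ← Finset.mul_sum, hiv] at hiii
    linarith
  have hd0 : ∀ p, d p = 0 := by
    intro p
    have h := (Finset.sum_eq_zero_iff_of_nonneg (fun q _ => sq_nonneg (d q))).1 hd2 p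
      (Finset.mem_univ _)
    exact pow_eq_zero_iff (n := 2) (by norm_num) |>.1 h
  -- so `σ₂` preserves `a` and `b`, hence is the identity
  have hσ₂ : σ₂ = 1 := by
    ext p
    have ha : a (σ₂ p) = a p := by have := hd0 p; simp only [hd] at this; linarith
    simpa using hinj _ _ ha (h₂ p)
  refine ⟨hσ₂, ?_⟩
  ext p
  have hc : c (σ₁ p) = c p := by simpa [hσ₂] using h₃ p
  have hb : b (σ₁ p) = b p := by
    have := hsum (σ₁ p); have := hsum p; have := h₁ p; linarith
  simpa using hinj _ _ (h₁ p) hb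


/-! ### Part B: Young subgroups and their umvirate pieces -/

variable {n : ℕ} {ι : Type*} [DecidableEq ι]

/-- The Young subgroup of a labelling, as a `Finset` of permutations. -/
def young (f : Fin n → ι) : Finset (Perm (Fin n)) :=
  Finset.univ.filter (fun g => ∀ x, f (g x) = f x)

@[simp] theorem mem_young {f : Fin n → ι} {g : Perm (Fin n)} :
    g ∈ young f ↔ ∀ x, f (g x) = f x := by
  simp [young]

/-- `|Y_f| = ∏ᵢ |f⁻¹(i)|!`. -/
theorem card_young [Fintype ι] (f : Fin n → ι) :
    (young f).card = ∏ i, (Fintype.card {x // f x = i}).factorial := by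
  rw [← DomMulAct.stabilizer_card f, young, ← Fintype.card_subtype]
  refine Fintype.card_congr (Equiv.subtypeEquivRight fun g => ?_)
  simp [funext_iff]

section Refine

variable {t : ℕ} (f : Fin n → ι) (I : Fin t → Fin n)

/-- Tag singling out the points of `range I`: `x ↦ x+1` on `range I`, `0` elsewhere. -/
def tag (x : Fin n) : Fin (n + 1) := if ∃ k, I k = x then x.succ else 0

/-- The refined labelling: `f` together with the tag of `I`. -/
def refined (x : Fin n) : ι × Fin (n + 1) := (f x, tag I x)

theorem tag_eq_zero_iff (x : Fin n) : tag I x = 0 ↔ ∀ k, I k ≠ x := by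
  unfold tag
  split_ifs with h
  · simp only [Fin.succ_ne_zero, false_iff, not_forall, not_not]; exact h
  · simp only [true_iff]; exact fun k hk => h ⟨k, hk⟩

theorem tag_apply (k : Fin t) : tag I (I k) = (I k).succ := by
  unfold tag; rw [if_pos ⟨k, rfl⟩]

/-- Preserving the refined labelling = preserving `f` and fixing `range I` pointwise. -/
theorem forall_refined_iff (h : Perm (Fin n)) :
    (∀ x, refined f I (h x) = refined f I x) ↔ (∀ x, f (h x) = f x) ∧ ∀ k, h (I k) = I k := by
  constructor
  · intro H
    refine ⟨fun x => (Prod.ext_iff.1 (H x)).1, fun k => ?_⟩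
    have h2 : tag I (h (I k)) = tag I (I k) := (Prod.ext_iff.1 (H (I k))).2
    rw [tag_apply] at h2
    unfold tag at h2
    split_ifs at h2 with hx
    · exact Fin.succ_injective _ h2
    · exact absurd h2 (Fin.succ_ne_zero _).symm
  · rintro ⟨Hf, HI⟩ x
    refine Prod.ext (Hf x) ?_
    show tag I (h x) = tag I x
    by_cases hx : ∃ k, I k = x
    · obtain ⟨k, rfl⟩ := hx
      rw [HI k]
    · have hx' : ∀ k, I k ≠ x := fun k hk => hx ⟨k, hk⟩
      have hhx : ∀ k, I k ≠ h x := by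
        intro k hk
        apply hx' k
        apply h.injective
        rw [HI k, hk]
      rw [(tag_eq_zero_iff I x).2 hx', (tag_eq_zero_iff I (h x)).2 hhx]

/-- **Translate:** a non-empty umvirate piece of `Y_f` has the cardinality of the refined Young
subgroup. -/
theorem card_young_filter_eq {L : Fin t → Fin n} {σ₀ : Perm (Fin n)} (hσ₀ : σ₀ ∈ young f)
    (hσ₀L : ∀ k, σ₀ (I k) = L k) :
    ((young f).filter (fun g => ∀ k, g (I k) = L k)).card = (young (refined f I)).card := by
  rw [mem_young] at hσ₀
  refine Finset.card_nbij' (fun g => σ₀⁻¹ * g) (fun h => σ₀ * h) ?_ ?_ ?_ ?_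
  · intro g hg
    rw [Finset.coe_filter, Set.mem_setOf_eq, mem_young] at hg
    rw [Finset.mem_coe, mem_young, forall_refined_iff]
    refine ⟨fun x => ?_, fun k => ?_⟩
    · rw [Perm.mul_apply]
      have := hσ₀ (σ₀⁻¹ (g x))
      simp only [Perm.coe_inv, Equiv.apply_symm_apply] at this
      rw [Perm.coe_inv, ← this, hg.1 x]
    · rw [Perm.mul_apply, hg.2 k, ← hσ₀L k]
      simp
  · intro h hh
    rw [Finset.mem_coe, mem_young, forall_refined_iff] at hh
    rw [Finset.coe_filter, Set.mem_setOf_eq, mem_young]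
    refine ⟨fun x => ?_, fun k => ?_⟩
    · rw [Perm.mul_apply, hσ₀, hh.1]
    · rw [Perm.mul_apply, hh.2 k, hσ₀L k]
  · intro g _; simp [← mul_assoc]
  · intro g _; simp [← mul_assoc]

/-- Fibres of the refined labelling over a non-zero tag have at most one point. -/
theorem card_fibre_refined_succ_le (i : ι) (j : Fin n) :
    Fintype.card {x // refined f I x = (i, j.succ)} ≤ 1 := by
  refine Fintype.card_le_one_iff_subsingleton.2 ⟨fun x y => ?_⟩
  obtain ⟨x, hx⟩ := x; obtain ⟨y, hy⟩ := y
  have hx2 : tag I x = j.succ := (Prod.ext_iff.1 hx).2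
  have hy2 : tag I y = j.succ := (Prod.ext_iff.1 hy).2
  unfold tag at hx2 hy2
  split_ifs at hx2 hy2 with h1 h2 h2
  · exact Subtype.ext (Fin.succ_injective _ (hx2.trans hy2.symm))
  · exact absurd hy2.symm (Fin.succ_ne_zero _)
  · exact absurd hx2.symm (Fin.succ_ne_zero _)
  · exact absurd hx2.symm (Fin.succ_ne_zero _)

/-- The number of source points `I k` in block `i`. -/
def blockHits (i : ι) : ℕ :=
  ((Finset.univ.filter (fun x : Fin n => f x = i)).filter (fun x => ¬ ∀ k, I k ≠ x)).card

/-- Fibre of the refined labelling over tag `0` = block minus the source points. -/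
theorem card_fibre_refined_zero (i : ι) :
    Fintype.card {x // refined f I x = (i, 0)} + blockHits f I i = Fintype.card {x // f x = i} := by
  rw [Fintype.card_subtype, Fintype.card_subtype, blockHits]
  have hsplit :
      ((Finset.univ.filter (fun x : Fin n => f x = i)).filter (fun x => ∀ k, I k ≠ x)).card +
        ((Finset.univ.filter (fun x : Fin n => f x = i)).filter (fun x => ¬ ∀ k, I k ≠ x)).card =
        (Finset.univ.filter (fun x : Fin n => f x = i)).card :=
    Finset.card_filter_add_card_filter_not _
  have hA : (Finset.univ.filter (fun x => refined f I x = (i, 0))) =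
      (Finset.univ.filter (fun x : Fin n => f x = i)).filter (fun x => ∀ k, I k ≠ x) := by
    ext x
    simp only [Finset.mem_filter, Finset.mem_univ, true_and, refined, Prod.ext_iff,
      tag_eq_zero_iff]
  rw [hA]
  exact hsplit

theorem blockHits_le (i : ι) : blockHits f I i ≤ Fintype.card {x // f x = i} := by
  have := card_fibre_refined_zero f I i; omega

theorem sum_blockHits [Fintype ι] (hI : Function.Injective I) : ∑ i, blockHits f I i = t := by
  unfold blockHits
  have h := Finset.card_eq_sum_card_fiberwise (f := f)
    (s := (Finset.univ : Finset (Fin n)).filter (fun x => ¬ ∀ k, I k ≠ x)) (t := Finset.univ)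
    (fun _ _ => Finset.mem_univ _)
  have hR : ((Finset.univ : Finset (Fin n)).filter (fun x => ¬ ∀ k, I k ≠ x)).card = t := by
    have : (Finset.univ : Finset (Fin n)).filter (fun x => ¬ ∀ k, I k ≠ x) =
        Finset.univ.image I := by
      ext x
      simp only [Finset.mem_filter, Finset.mem_univ, true_and, not_forall, not_not,
        Finset.mem_image]
    rw [this, Finset.card_image_of_injective _ hI, Finset.card_univ, Fintype.card_fin]
  rw [hR] at h
  refine Eq.trans (Finset.sum_congr rfl fun i _ => ?_) h.symm
  rw [Finset.filter_filter, Finset.filter_filter]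
  congr 1
  exact Finset.filter_congr fun x _ => and_comm

/-- `|Y_{refined}| = ∏ᵢ (bᵢ - rᵢ)!`. -/
theorem card_young_refined [Fintype ι] :
    (young (refined f I)).card =
      ∏ i, (Fintype.card {x // f x = i} - blockHits f I i).factorial := by
  rw [card_young, Fintype.prod_prod_type]
  refine Finset.prod_congr rfl fun i _ => ?_
  rw [Fin.prod_univ_succ]
  have h1 : ∏ j : Fin n, (Fintype.card {x // refined f I x = (i, j.succ)}).factorial = 1 := by
    refine Finset.prod_eq_one fun j _ => ?_
    exact Nat.factorial_eq_one.2 (card_fibre_refined_succ_le f I i j)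
  rw [h1, mul_one]
  congr 1
  have := card_fibre_refined_zero f I i
  omega

end Refine

/-! ### The analytic bound `(b/e)^r ≤ b^(r)` -/

theorem pow_succ_le_exp_mul_pow (b r : ℕ) (hr : r ≤ b) :
    ((b : ℝ) + 1) ^ r ≤ Real.exp 1 * (b : ℝ) ^ r := by
  rcases Nat.eq_zero_or_pos b with rfl | hb
  · have : r = 0 := by omega
    subst this
    simp
  have hb' : (0 : ℝ) < b := by exact_mod_cast hb
  -- `(1 + 1/b)^r ≤ (1 + 1/b)^b ≤ exp(1/b)^b = e`
  have hge1 : (1 : ℝ) ≤ 1 + 1 / (b : ℝ) := by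
    have : (0 : ℝ) ≤ 1 / (b : ℝ) := by positivity
    linarith
  have h1 : (1 + 1 / (b : ℝ)) ^ r ≤ Real.exp 1 := by
    calc (1 + 1 / (b : ℝ)) ^ r ≤ (1 + 1 / (b : ℝ)) ^ b := pow_le_pow_right₀ hge1 hr
      _ ≤ (Real.exp (1 / (b : ℝ))) ^ b := by
          apply pow_le_pow_left₀ (by positivity)
          have := Real.add_one_le_exp (1 / (b : ℝ)); linarith
      _ = Real.exp 1 := by rw [← Real.exp_nat_mul]; congr 1; field_simp
  have h2 : ((b : ℝ) + 1) ^ r = (b : ℝ) ^ r * (1 + 1 / (b : ℝ)) ^ r := by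
    rw [← mul_pow]; congr 1; field_simp
  rw [h2, mul_comm (Real.exp 1)]
  exact mul_le_mul_of_nonneg_left h1 (by positivity)

/-- `b^r ≤ e^r · b^(r)` for `r ≤ b`, i.e. `(b/e)^r ≤ b!/(b-r)!`. -/
theorem pow_le_exp_mul_descFactorial : ∀ (b r : ℕ), r ≤ b →
    ((b : ℝ)) ^ r ≤ Real.exp 1 ^ r * (b.descFactorial r : ℝ)
  | 0, r, hr => by
      have : r = 0 := by omega
      subst this; simp
  | b + 1, 0, _ => by simp
  | b + 1, r + 1, hr => by
      have ih := pow_le_exp_mul_descFactorial b r (by omega)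
      rw [Nat.succ_descFactorial_succ, Nat.cast_mul, pow_succ, pow_succ]
      push_cast
      have h1 := pow_succ_le_exp_mul_pow b r (by omega)
      have hb1 : (0 : ℝ) ≤ (b : ℝ) + 1 := by positivity
      calc ((b : ℝ) + 1) ^ r * ((b : ℝ) + 1) ≤ (Real.exp 1 * (b : ℝ) ^ r) * ((b : ℝ) + 1) :=
            mul_le_mul_of_nonneg_right h1 hb1
        _ ≤ (Real.exp 1 * (Real.exp 1 ^ r * (b.descFactorial r : ℝ))) * ((b : ℝ) + 1) :=
            mul_le_mul_of_nonneg_right (mul_le_mul_of_nonneg_left ih (Real.exp_nonneg _)) hb1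
        _ = Real.exp 1 ^ r * Real.exp 1 * (((b : ℝ) + 1) * (b.descFactorial r : ℝ)) := by ring

/-- `(s/e)^r ≤ b^(r)` whenever `s ≤ b` and `r ≤ b`. -/
theorem div_exp_pow_le_descFactorial {s b r : ℕ} (hsb : s ≤ b) (hr : r ≤ b) :
    ((s : ℝ) / Real.exp 1) ^ r ≤ (b.descFactorial r : ℝ) := by
  have h := pow_le_exp_mul_descFactorial b r hr
  have he : (0 : ℝ) < Real.exp 1 ^ r := pow_pos (Real.exp_pos _) _
  rw [div_pow, div_le_iff₀ he]
  calc (s : ℝ) ^ r ≤ (b : ℝ) ^ r := pow_le_pow_left₀ (Nat.cast_nonneg _) (by exact_mod_cast hsb) r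
    _ ≤ Real.exp 1 ^ r * (b.descFactorial r : ℝ) := h
    _ = (b.descFactorial r : ℝ) * Real.exp 1 ^ r := mul_comm _ _

/-! ### The Young bump bound and the Young volume bound -/

/-- **Young bump bound.** If every block of `f` has at least `s` points then for injective
`I : Fin t → Fin n` and any `L`: `|Y_f ∩ U_{I→L}| · (s/e)^t ≤ |Y_f|`. -/
theorem young_bump [Fintype ι] {s : ℕ} (f : Fin n → ι)
    (hs : ∀ i, s ≤ Fintype.card {x // f x = i})
    {t : ℕ} (I L : Fin t → Fin n) (hI : Function.Injective I) :
    (((young f).filter (fun g => ∀ k, g (I k) = L k)).card : ℝ) * ((s : ℝ) / Real.exp 1) ^ t ≤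
      (young f).card := by
  rcases ((young f).filter (fun g => ∀ k, g (I k) = L k)).eq_empty_or_nonempty with h0 | ⟨σ₀, hσ₀⟩
  · rw [h0]; simp
  rw [Finset.mem_filter] at hσ₀
  rw [card_young_filter_eq f I hσ₀.1 hσ₀.2, card_young_refined f I, card_young f]
  -- `∏ (bᵢ - rᵢ)! · (s/e)^{Σ rᵢ} ≤ ∏ bᵢ! = ∏ (bᵢ-rᵢ)! bᵢ^(rᵢ)`
  have ht : ((s : ℝ) / Real.exp 1) ^ t = ∏ i, ((s : ℝ) / Real.exp 1) ^ blockHits f I i := by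
    rw [Finset.prod_pow_eq_pow_sum, sum_blockHits f I hI]
  rw [ht, Nat.cast_prod, Nat.cast_prod, ← Finset.prod_mul_distrib]
  refine Finset.prod_le_prod (fun i _ => by positivity) fun i _ => ?_
  have hr := blockHits_le f I i
  rw [← Nat.factorial_mul_descFactorial hr, Nat.cast_mul]
  exact mul_le_mul_of_nonneg_left (div_exp_pow_le_descFactorial (hs i) hr) (Nat.cast_nonneg _)

/-- **Young volume bound.** If every block of `f` has at least `s` points then
`(s/e)^n ≤ |Y_f|`. -/
theorem young_volume [Fintype ι] {s : ℕ} (f : Fin n → ι)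
    (hs : ∀ i, s ≤ Fintype.card {x // f x = i}) :
    ((s : ℝ) / Real.exp 1) ^ n ≤ (young f).card := by
  rw [card_young f, Nat.cast_prod]
  have hn : ∑ i, Fintype.card {x // f x = i} = n := by
    rw [← Fintype.card_sigma, Fintype.card_congr (Equiv.sigmaFiberEquiv f), Fintype.card_fin]
  have hpow : ((s : ℝ) / Real.exp 1) ^ n = ∏ i, ((s : ℝ) / Real.exp 1) ^ Fintype.card {x // f x = i} := by
    rw [Finset.prod_pow_eq_pow_sum, hn]
  rw [hpow]
  refine Finset.prod_le_prod (fun i _ => by positivity) fun i _ => ?_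
  have h := div_exp_pow_le_descFactorial (hs i) le_rfl
  rwa [Nat.descFactorial_self] at h


/-! ### Part C: the hexagon -/

/-- Points of the BCCGU17 hexagon of "radius" `R`: `v : Fin 3 → [0, 2R]` with `Σ v = 3R`
(barycentric coordinates `a + b + c = 3R` of the triangular lattice). -/
abbrev HexPt (R : ℕ) : Type :=
  {v : Fin 3 → Fin (2 * R + 1) // ∑ j, (v j : ℕ) = 3 * R}

namespace HexPt

variable {R : ℕ}

/-- Permuting the three coordinates is a symmetry of the hexagon. -/
def perm (π : Perm (Fin 3)) : HexPt R ≃ HexPt R where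
  toFun p := ⟨p.1 ∘ π, (Equiv.sum_comp π (fun j => (p.1 j : ℕ))).trans p.2⟩
  invFun p := ⟨p.1 ∘ π.symm, (Equiv.sum_comp π.symm (fun j => (p.1 j : ℕ))).trans p.2⟩
  left_inv p := by ext j; simp
  right_inv p := by ext j; simp

theorem sum_three (p : HexPt R) : (p.1 0 : ℕ) + p.1 1 + p.1 2 = 3 * R := by
  have := p.2; rwa [Fin.sum_univ_three] at this

/-- Two coordinates determine the point. -/
theorem ext01 {p q : HexPt R} (h0 : p.1 0 = q.1 0) (h1 : p.1 1 = q.1 1) : p = q := by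
  have hp := sum_three p
  have hq := sum_three q
  have h2 : p.1 2 = q.1 2 := by
    apply Fin.ext
    have h0' : (p.1 0 : ℕ) = q.1 0 := by rw [h0]
    have h1' : (p.1 1 : ℕ) = q.1 1 := by rw [h1]
    omega
  apply Subtype.ext
  funext j
  fin_cases j
  · exact h0
  · exact h1
  · exact h2

/-- The hexagon has at most `(2R+1)²` points. -/
theorem card_le : Fintype.card (HexPt R) ≤ (2 * R + 1) ^ 2 := by
  have h := Fintype.card_le_of_injective (fun p : HexPt R => (p.1 0, p.1 1))
    (fun p q hpq => ext01 (Prod.ext_iff.1 hpq).1 (Prod.ext_iff.1 hpq).2)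
  simpa [sq] using h

/-- Every line `{v 0 = i}` of the hexagon has at least `R + 1` points: an explicit injection. -/
def lineZero (i : Fin (2 * R + 1)) (k : Fin (R + 1)) : {p : HexPt R // p.1 0 = i} := by
  refine ⟨⟨![i, ⟨R - min (i : ℕ) R + k, ?_⟩, ⟨3 * R - i - (R - min (i : ℕ) R + k), ?_⟩], ?_⟩, ?_⟩
  · have hk := k.isLt
    have : min (i : ℕ) R ≤ R := min_le_right _ _
    omega
  · have hi := i.isLt
    have hk := k.isLt
    have h1 : min (i : ℕ) R ≤ (i : ℕ) := min_le_left _ _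
    omega
  · rw [Fin.sum_univ_three]
    simp only [Matrix.cons_val_zero, Matrix.cons_val_one, Matrix.cons_val]
    have hi := i.isLt
    have hk := k.isLt
    have h1 : min (i : ℕ) R ≤ (i : ℕ) := min_le_left _ _
    have h2 : min (i : ℕ) R ≤ R := min_le_right _ _
    rcases le_total (i : ℕ) R with h | h
    · rw [min_eq_left h]; omega
    · rw [min_eq_right h]; omega
  · simp

theorem lineZero_injective (i : Fin (2 * R + 1)) : Function.Injective (lineZero (R := R) i) := by
  intro k k' h
  have h1 := congrArg (fun p : {p : HexPt R // p.1 0 = i} => ((p.1.1 1 : ℕ))) h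
  simp only [lineZero, Matrix.cons_val_one, Matrix.cons_val_zero] at h1
  exact Fin.ext (by omega)

theorem card_line (j : Fin 3) (i : Fin (2 * R + 1)) :
    R + 1 ≤ Fintype.card {p : HexPt R // p.1 j = i} := by
  have h0 : R + 1 ≤ Fintype.card {p : HexPt R // p.1 0 = i} := by
    simpa using Fintype.card_le_of_injective _ (lineZero_injective i)
  refine h0.trans_eq (Fintype.card_congr ?_)
  refine (perm (Equiv.swap 0 j)).subtypeEquiv fun p => ?_
  simp [perm]

/-- The hexagon has at least `R + 1` points. -/
theorem succ_le_card : R + 1 ≤ Fintype.card (HexPt R) :=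
  (card_line (R := R) 0 0).trans (Fintype.card_subtype_le _)

end HexPt


/-! ### Part D: the hexagon Young triple in `S_n`, `n = |HexPt R|` -/

section Assembly

variable (R : ℕ)

/-- Number of points of the hexagon of radius `R`. -/
def hexN : ℕ := Fintype.card (HexPt R)

/-- A fixed enumeration of the hexagon. -/
def hexEquiv : Fin (hexN R) ≃ HexPt R := (Fintype.equivFin (HexPt R)).symm

/-- The three coordinate labellings of `[n]`, `n = |HexPt R|`. -/
def hexLabel (j : Fin 3) (x : Fin (hexN R)) : Fin (2 * R + 1) := (hexEquiv R x).1 j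

/-- The three line-stabilisers (Young subgroups) of the hexagon, as `Finset`s of `S_n`. -/
def hexYoung (j : Fin 3) : Finset (Perm (Fin (hexN R))) := young (hexLabel R j)

theorem succ_le_hexN : R + 1 ≤ hexN R := HexPt.succ_le_card

theorem hexN_pos : 0 < hexN R := lt_of_lt_of_le (Nat.succ_pos R) (succ_le_hexN R)

theorem hexN_le : hexN R ≤ 4 * (R + 1) ^ 2 :=
  (HexPt.card_le).trans <|
    calc (2 * R + 1) ^ 2 ≤ (2 * (R + 1)) ^ 2 := Nat.pow_le_pow_left (by omega) 2
      _ = 4 * (R + 1) ^ 2 := by ring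

/-- Every block of every coordinate labelling has at least `R + 1` points. -/
theorem card_block_hexLabel (j : Fin 3) (i : Fin (2 * R + 1)) :
    R + 1 ≤ Fintype.card {x // hexLabel R j x = i} := by
  refine (HexPt.card_line j i).trans_eq (Fintype.card_congr ?_).symm
  exact (hexEquiv R).subtypeEquiv fun x => Iff.rfl

/-- `hexYoung R j` is the tree's Young subgroup of the labelling `hexLabel R j`, as a `Finset`. -/
theorem hexYoung_eq_filter_mem_youngSubgroup (j : Fin 3) :
    hexYoung R j = Finset.univ.filter (· ∈ youngSubgroup (hexLabel R j)) := by
  ext g; simp [hexYoung, young, mem_youngSubgroup]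

/-- **The hexagon Young triple has the triple product property.** -/
theorem hexYoung_tpp : TripleProductProperty (hexYoung R 0) (hexYoung R 1) (hexYoung R 2) := by
  intro s hs s' hs' t ht t' ht' u hu u' hu' heq
  simp only [hexYoung, mem_young] at hs hs' ht ht' hu hu'
  -- integer coordinates on `Fin n`
  let crd : Fin 3 → Fin (hexN R) → ℤ := fun j x => ((hexLabel R j x : ℕ) : ℤ)
  have hsum : ∀ x, crd 0 x + crd 1 x + crd 2 x = 3 * R := by
    intro x
    have h := HexPt.sum_three (hexEquiv R x)
    simp only [crd, hexLabel]
    exact_mod_cast h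
  have hinj : ∀ x y, crd 0 x = crd 0 y → crd 1 x = crd 1 y → x = y := by
    intro x y h0 h1
    simp only [crd, Nat.cast_inj] at h0 h1
    apply (hexEquiv R).injective
    exact HexPt.ext01 (Fin.ext h0) (Fin.ext h1)
  -- preservation of coordinates by quotients of stabiliser elements
  have pres : ∀ (j : Fin 3) (g g' : Perm (Fin (hexN R))),
      (∀ x, hexLabel R j (g x) = hexLabel R j x) → (∀ x, hexLabel R j (g' x) = hexLabel R j x) →
      ∀ x, crd j ((g * g'⁻¹) x) = crd j x := by
    intro j g g' hg hg' x
    simp only [crd, Perm.mul_apply]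
    rw [hg]
    have := hg' (g'⁻¹ x)
    simp only [Perm.coe_inv, Equiv.apply_symm_apply] at this
    rw [Perm.coe_inv, ← this]
  have h₁ := pres 0 s s' hs hs'
  have h₂ := pres 1 t t' ht ht'
  have h₃' := pres 2 u u' hu hu'
  -- `σ₁ σ₂ = σ₃⁻¹` preserves the third coordinate
  have hprod : s * s'⁻¹ * (t * t'⁻¹) = (u * u'⁻¹)⁻¹ := by
    rw [← mul_eq_one_iff_eq_inv]; exact heq
  have h₃ : ∀ x, crd 2 ((s * s'⁻¹) ((t * t'⁻¹) x)) = crd 2 x := by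
    intro x
    have hx := h₃' ((u * u'⁻¹)⁻¹ x)
    rw [← Perm.mul_apply, mul_inv_cancel, Perm.one_apply] at hx
    rw [← Perm.mul_apply, hprod]
    exact hx.symm
  obtain ⟨hσ₂, hσ₁⟩ := planar_core (crd 0) (crd 1) (crd 2) (3 * R) hsum hinj
    (s * s'⁻¹) (t * t'⁻¹) h₁ h₂ h₃
  have hσ₃ : u * u'⁻¹ = 1 := by
    rw [hσ₁, hσ₂, one_mul, one_mul] at heq; exact heq
  exact ⟨mul_inv_eq_one.1 hσ₁, mul_inv_eq_one.1 hσ₂, mul_inv_eq_one.1 hσ₃⟩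

/-- **Bump bound for the hexagon Young subgroups**: with `s = R + 1`,
`|Y ∩ U_{I→L}|·((R+1)/e)^t ≤ |Y|` for every injective `t`-tuple `I` and every `L`. -/
theorem hexYoung_bump_raw (j : Fin 3) {t : ℕ} (I L : Fin t → Fin (hexN R))
    (hI : Function.Injective I) :
    (((hexYoung R j).filter (fun g => ∀ k, g (I k) = L k)).card : ℝ) *
        (((R + 1 : ℕ) : ℝ) / Real.exp 1) ^ t ≤ (hexYoung R j).card :=
  young_bump (hexLabel R j) (card_block_hexLabel R j) I L hI

/-- **Volume of the hexagon Young subgroups**: `((R+1)/e)^n ≤ |Y|`. -/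
theorem hexYoung_volume_raw (j : Fin 3) :
    (((R + 1 : ℕ) : ℝ) / Real.exp 1) ^ hexN R ≤ (hexYoung R j).card :=
  young_volume (hexLabel R j) (card_block_hexLabel R j)

/-- The block size dominates `√n / 2`: `n ≤ 4 (R+1)²`, in real form `√n ≤ 2 (R+1)`. -/
theorem sqrt_hexN_le : Real.sqrt (hexN R : ℝ) ≤ 2 * ((R + 1 : ℕ) : ℝ) := by
  rw [Real.sqrt_le_left (by positivity)]
  have h : ((hexN R : ℕ) : ℝ) ≤ ((4 * (R + 1) ^ 2 : ℕ) : ℝ) := by exact_mod_cast hexN_le R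
  push_cast at h ⊢
  nlinarith

/-- **The hexagon Young subgroups are `(1/2+ε)`-bump-free at EVERY level** once `n^ε ≥ 2e`:
`|Y ∩ U_{I→L}|·n^(t) ≤ n^{(1/2+ε)t}·|Y|` for all `t` and all injective `I` (any `L`). -/
theorem hexYoung_bump (j : Fin 3) {ε : ℝ} (hε : 2 * Real.exp 1 ≤ (hexN R : ℝ) ^ ε) {t : ℕ}
    (I L : Fin t → Fin (hexN R)) (hI : Function.Injective I) :
    (((hexYoung R j).filter (fun g => ∀ k, g (I k) = L k)).card : ℝ) *
        ((hexN R).descFactorial t : ℝ) ≤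
      ((hexN R : ℕ) : ℝ) ^ ((1 / 2 + ε) * t) * (hexYoung R j).card := by
  have hn0 : (0 : ℝ) < (hexN R : ℝ) := Nat.cast_pos.2 (hexN_pos R)
  have hs0 : (0 : ℝ) < ((R + 1 : ℕ) : ℝ) := Nat.cast_pos.2 (Nat.succ_pos R)
  have he0 : 0 < Real.exp 1 := Real.exp_pos 1
  have hraw := hexYoung_bump_raw R j I L hI
  -- `n^(t) ≤ n^t = (s/e)^t · (e n / s)^t` and `e n / s ≤ 2 e √n ≤ n^ε √n = n^{1/2+ε}`
  have hdesc : ((hexN R).descFactorial t : ℝ) ≤ (hexN R : ℝ) ^ t := by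
    exact_mod_cast Nat.descFactorial_le_pow (hexN R) t
  have hkey : Real.exp 1 * (hexN R : ℝ) / ((R + 1 : ℕ) : ℝ) ≤ (hexN R : ℝ) ^ (1 / 2 + ε) := by
    have hsq : Real.sqrt (hexN R : ℝ) ≤ 2 * ((R + 1 : ℕ) : ℝ) := sqrt_hexN_le R
    have hsqrt_pos : 0 < Real.sqrt (hexN R : ℝ) := Real.sqrt_pos.2 hn0
    rw [Real.rpow_add hn0, ← Real.sqrt_eq_rpow, div_le_iff₀ hs0]
    have hnn : (hexN R : ℝ) = Real.sqrt (hexN R : ℝ) * Real.sqrt (hexN R : ℝ) :=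
      (Real.mul_self_sqrt hn0.le).symm
    calc Real.exp 1 * (hexN R : ℝ)
          = Real.exp 1 * Real.sqrt (hexN R : ℝ) * Real.sqrt (hexN R : ℝ) := by
          rw [mul_assoc, ← hnn]
      _ ≤ Real.exp 1 * Real.sqrt (hexN R : ℝ) * (2 * ((R + 1 : ℕ) : ℝ)) :=
          mul_le_mul_of_nonneg_left hsq (by positivity)
      _ = (2 * Real.exp 1) * Real.sqrt (hexN R : ℝ) * ((R + 1 : ℕ) : ℝ) := by ring
      _ ≤ (hexN R : ℝ) ^ ε * Real.sqrt (hexN R : ℝ) * ((R + 1 : ℕ) : ℝ) := by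
          apply mul_le_mul_of_nonneg_right _ hs0.le
          exact mul_le_mul_of_nonneg_right hε hsqrt_pos.le
      _ = Real.sqrt (hexN R : ℝ) * (hexN R : ℝ) ^ ε * ((R + 1 : ℕ) : ℝ) := by ring
  have hkey' : (Real.exp 1 * (hexN R : ℝ) / ((R + 1 : ℕ) : ℝ)) ^ t ≤
      (hexN R : ℝ) ^ ((1 / 2 + ε) * t) := by
    rw [Real.rpow_mul_natCast hn0.le]
    exact pow_le_pow_left₀ (by positivity) hkey t
  have hsplit : (hexN R : ℝ) ^ t = (((R + 1 : ℕ) : ℝ) / Real.exp 1) ^ t *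
      (Real.exp 1 * (hexN R : ℝ) / ((R + 1 : ℕ) : ℝ)) ^ t := by
    rw [← mul_pow]; congr 1; field_simp
  have hA0 : (0 : ℝ) ≤ (((hexYoung R j).filter (fun g => ∀ k, g (I k) = L k)).card : ℝ) :=
    Nat.cast_nonneg _
  calc (((hexYoung R j).filter (fun g => ∀ k, g (I k) = L k)).card : ℝ) *
        ((hexN R).descFactorial t : ℝ)
        ≤ (((hexYoung R j).filter (fun g => ∀ k, g (I k) = L k)).card : ℝ) * (hexN R : ℝ) ^ t :=
        mul_le_mul_of_nonneg_left hdesc hA0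
    _ = (((hexYoung R j).filter (fun g => ∀ k, g (I k) = L k)).card : ℝ) *
          (((R + 1 : ℕ) : ℝ) / Real.exp 1) ^ t *
          (Real.exp 1 * (hexN R : ℝ) / ((R + 1 : ℕ) : ℝ)) ^ t := by rw [hsplit, mul_assoc]
    _ ≤ ((hexYoung R j).card : ℝ) * (hexN R : ℝ) ^ ((1 / 2 + ε) * t) :=
        mul_le_mul hraw hkey' (by positivity) (Nat.cast_nonneg _)
    _ = (hexN R : ℝ) ^ ((1 / 2 + ε) * t) * (hexYoung R j).card := mul_comm _ _

/-- **Volume of the hexagon Young triple**: `|Y₀||Y₁||Y₂| > (n!)^{3/2} e^{-7n}`. -/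
theorem hexYoung_volume :
    ((hexN R).factorial : ℝ) ^ ((3 : ℝ) / 2) * Real.exp (-(7 * (hexN R : ℝ))) <
      (((hexYoung R 0).card * (hexYoung R 1).card * (hexYoung R 2).card : ℕ) : ℝ) := by
  set n := hexN R with hn
  set s : ℝ := ((R + 1 : ℕ) : ℝ) with hs
  have hn0 : 0 < n := hexN_pos R
  have hn0' : (0 : ℝ) < n := by exact_mod_cast hn0
  have hs1 : 1 ≤ s := by rw [hs]; exact_mod_cast Nat.le_add_left 1 R
  have hs0 : 0 < s := by linarith
  -- lower bound on each factor
  have hvol : ∀ j, (s / Real.exp 1) ^ n ≤ ((hexYoung R j).card : ℝ) := hexYoung_volume_raw R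
  have hpos : 0 < (s / Real.exp 1) ^ n := pow_pos (div_pos hs0 (Real.exp_pos 1)) n
  have hYpos : ∀ j, (0 : ℝ) < ((hexYoung R j).card : ℝ) := fun j => hpos.trans_le (hvol j)
  -- compare logarithms
  have hlogY : ∀ j, n * (Real.log s - 1) ≤ Real.log ((hexYoung R j).card : ℝ) := by
    intro j
    have h := Real.log_le_log hpos (hvol j)
    rwa [Real.log_pow, Real.log_div hs0.ne' (Real.exp_pos 1).ne', Real.log_exp] at h
  have hfact : Real.log (n.factorial : ℝ) ≤ n * Real.log n := by
    have h1 : (n.factorial : ℝ) ≤ (n : ℝ) ^ n := by exact_mod_cast Nat.factorial_le_pow n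
    have h2 := Real.log_le_log (by exact_mod_cast Nat.factorial_pos n) h1
    rwa [Real.log_pow] at h2
  have hlogn : Real.log n ≤ Real.log 4 + 2 * Real.log s := by
    have h4 : (n : ℝ) ≤ 4 * s ^ 2 := by
      have := hexN_le R
      rw [hs]; exact_mod_cast this
    have h := Real.log_le_log hn0' h4
    rwa [Real.log_mul (by norm_num) (by positivity), Real.log_pow, Nat.cast_ofNat] at h
  have hlog4 : Real.log 4 < 2 := by
    rw [Real.log_lt_iff_lt_exp (by norm_num)]
    have := Real.exp_one_gt_d9
    have h2 : Real.exp 2 = Real.exp 1 * Real.exp 1 := by rw [← Real.exp_add]; norm_num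
    nlinarith
  -- the volume and the bound, in logs
  set V : ℝ := (((hexYoung R 0).card * (hexYoung R 1).card * (hexYoung R 2).card : ℕ) : ℝ)
    with hV
  have hVeq : V = ((hexYoung R 0).card : ℝ) * ((hexYoung R 1).card : ℝ) *
      ((hexYoung R 2).card : ℝ) := by rw [hV]; push_cast; ring
  have hV0 : 0 < V := by rw [hVeq]; exact mul_pos (mul_pos (hYpos 0) (hYpos 1)) (hYpos 2)
  have hlogV : 3 * (n * (Real.log s - 1)) ≤ Real.log V := by
    rw [hVeq, Real.log_mul (mul_pos (hYpos 0) (hYpos 1)).ne' (hYpos 2).ne',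
      Real.log_mul (hYpos 0).ne' (hYpos 1).ne']
    linarith [hlogY 0, hlogY 1, hlogY 2]
  set M : ℝ := (n.factorial : ℝ) ^ ((3 : ℝ) / 2) * Real.exp (-(7 * (n : ℝ))) with hM
  have hM0 : 0 < M := by positivity
  have hlogM : Real.log M = (3 : ℝ) / 2 * Real.log (n.factorial : ℝ) + -(7 * (n : ℝ)) := by
    rw [hM, Real.log_mul (by positivity) (Real.exp_pos _).ne',
      Real.log_rpow (by exact_mod_cast Nat.factorial_pos n), Real.log_exp]
  rw [← Real.log_lt_log_iff hM0 hV0, hlogM]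
  have hlogs : 0 ≤ Real.log s := Real.log_nonneg hs1
  nlinarith [hlogV, hfact, hlogn, hlog4, hn0', hlogs, mul_le_mul_of_nonneg_left hlogn (by linarith : (0:ℝ) ≤ 3 / 2 * n)]

end Assembly

/-! ### The refuted strengthenings -/

/-- The crux with its conclusion strengthened to a SUPER-EXPONENTIAL saving `e^{-Cn}` for every
`C` (bump hypothesis verbatim as in the crux: levels `1 ≤ t ≤ √n`). -/
def GlobalBranchSuperExp : Prop :=
  ∃ ε : ℝ, 0 < ε ∧ ∀ C : ℝ, 0 < C → ∃ n₀ : ℕ, ∀ n ≥ n₀, ∀ S T U : Finset (Equiv.Perm (Fin n)),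
    TripleProductProperty S T U →
    (∀ X : Finset (Equiv.Perm (Fin n)), (X = S ∨ X = T ∨ X = U) → ∀ t : ℕ, 1 ≤ t →
      (t : ℝ) ≤ Real.sqrt (n : ℝ) → ∀ I L : Fin t → Fin n, Function.Injective I →
      Function.Injective L →
        ((X.filter (fun σ => ∀ k, σ (I k) = L k)).card : ℝ) * (n.descFactorial t : ℝ) ≤
          (n : ℝ) ^ ((1 / 2 + ε) * t) * (X.card : ℝ)) →
    ((S.card * T.card * U.card : ℕ) : ℝ) ≤
      (n.factorial : ℝ) ^ ((3 : ℝ) / 2) * Real.exp (-(C * (n : ℝ)))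

/-- **The all-levels super-exponential strengthening is false**: for every `ε > 0` the hexagon
Young triples (`n = |HexPt R|`, `R → ∞`) are TPP triples, `(1/2+ε)`-bump-free at every level
`1 ≤ t ≤ n` once `n^ε ≥ 2e`, with volume `> (n!)^{3/2} e^{-7n}`. -/
theorem not_globalBranchSuperExpAllLevels :
    ¬ ∃ ε : ℝ, 0 < ε ∧ ∀ C : ℝ, 0 < C → ∃ n₀ : ℕ, ∀ n ≥ n₀, ∀ S T U : Finset (Equiv.Perm (Fin n)),
      TripleProductProperty S T U →
      (∀ X : Finset (Equiv.Perm (Fin n)), (X = S ∨ X = T ∨ X = U) → ∀ t : ℕ, 1 ≤ t → t ≤ n →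
        ∀ I L : Fin t → Fin n, Function.Injective I → Function.Injective L →
          ((X.filter (fun σ => ∀ k, σ (I k) = L k)).card : ℝ) * (n.descFactorial t : ℝ) ≤
            (n : ℝ) ^ ((1 / 2 + ε) * t) * (X.card : ℝ)) →
      ((S.card * T.card * U.card : ℕ) : ℝ) ≤
        (n.factorial : ℝ) ^ ((3 : ℝ) / 2) * Real.exp (-(C * (n : ℝ))) := by
  rintro ⟨ε, hε, H⟩
  obtain ⟨n₀, hn₀⟩ := H 7 (by norm_num)
  -- radius: beyond `n₀` and beyond `(2e)^{1/ε}`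
  set R : ℕ := max n₀ ⌈(2 * Real.exp 1) ^ (1 / ε)⌉₊ with hR
  have hn : hexN R ≥ n₀ :=
    le_trans (le_max_left _ _) ((Nat.le_succ R).trans (succ_le_hexN R))
  have hεn : 2 * Real.exp 1 ≤ (hexN R : ℝ) ^ ε := by
    have h1 : (2 * Real.exp 1) ^ (1 / ε) ≤ (hexN R : ℝ) := by
      calc (2 * Real.exp 1) ^ (1 / ε) ≤ ⌈(2 * Real.exp 1) ^ (1 / ε)⌉₊ := Nat.le_ceil _
        _ ≤ (R : ℝ) := by exact_mod_cast le_max_right _ _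
        _ ≤ (hexN R : ℝ) := by exact_mod_cast (Nat.le_succ R).trans (succ_le_hexN R)
    have h2 := Real.rpow_le_rpow (by positivity) h1 hε.le
    rwa [← Real.rpow_mul (by positivity), one_div_mul_cancel hε.ne', Real.rpow_one] at h2
  have key := hn₀ (hexN R) hn (hexYoung R 0) (hexYoung R 1) (hexYoung R 2) (hexYoung_tpp R) ?_
  · exact absurd (hexYoung_volume R) (not_lt.2 key)
  · rintro X hX t - - I L hI -
    rcases hX with rfl | rfl | rfl <;> exact hexYoung_bump R _ hεn I L hI

/-- **The super-exponential strengthening of the crux is false** (from the all-levels form: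
`t ≤ √n` gives `t ≤ n`). -/
theorem not_globalBranchSuperExp : ¬ GlobalBranchSuperExp := by
  rintro ⟨ε, hε, H⟩
  refine not_globalBranchSuperExpAllLevels ⟨ε, hε, fun C hC => ?_⟩
  obtain ⟨n₀, hn₀⟩ := H C hC
  refine ⟨n₀, fun n hn S T U hTPP hB => hn₀ n hn S T U hTPP fun X hX t ht hts I L hI hL => ?_⟩
  refine hB X hX t ht ?_ I L hI hL
  -- `t ≤ √n` gives `t ≤ n`
  have hn1 : (1 : ℝ) ≤ n := by
    rcases Nat.eq_zero_or_pos n with rfl | hn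
    · exfalso
      have h1 : (1 : ℝ) ≤ Real.sqrt ((0 : ℕ) : ℝ) := le_trans (by exact_mod_cast ht) hts
      rw [Nat.cast_zero, Real.sqrt_zero] at h1
      exact absurd h1 (by norm_num)
    · exact_mod_cast hn
  have h1 : ((t : ℕ) : ℝ) ≤ n :=
    hts.trans ((Real.sqrt_le_left (by positivity)).2 (by nlinarith))
  exact_mod_cast h1


/-! ### Part E: right transversals of Young subgroups and the PAIRWISE strengthening -/

section Transversal

variable {n : ℕ} {ι : Type*} [DecidableEq ι] (f : Fin n → ι)

/-- The labellings of `[n]` realised by permutations: `{f ∘ g : g ∈ S_n}` (= the right cosets of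
`Y_f`). -/
def labellings : Finset (Fin n → ι) := Finset.univ.image (fun g : Perm (Fin n) => f ∘ (g : Fin n → Fin n))

theorem exists_rep (φ : Fin n → ι) (hφ : φ ∈ labellings f) : ∃ g : Perm (Fin n), f ∘ g = φ := by
  obtain ⟨g, -, hg⟩ := Finset.mem_image.1 hφ; exact ⟨g, hg⟩

/-- A chosen permutation realising a labelling (arbitrary off `labellings f`). -/
def rep (φ : Fin n → ι) : Perm (Fin n) :=
  if h : φ ∈ labellings f then Classical.choose (exists_rep f φ h) else 1

theorem comp_rep {φ : Fin n → ι} (hφ : φ ∈ labellings f) : f ∘ (rep f φ) = φ := by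
  unfold rep; rw [dif_pos hφ]; exact Classical.choose_spec (exists_rep f φ hφ)

/-- A right transversal of the Young subgroup `Y_f` in `S_n`: one permutation per realised
labelling. -/
def transversal : Finset (Perm (Fin n)) := (labellings f).image (rep f)

theorem rep_injOn : Set.InjOn (rep f) (labellings f : Set (Fin n → ι)) := by
  intro φ hφ φ' hφ' h
  rw [← comp_rep f hφ, ← comp_rep f hφ', h]

theorem card_transversal : (transversal f).card = (labellings f).card :=
  Finset.card_image_of_injOn (rep_injOn f)

theorem mem_transversal {τ : Perm (Fin n)} :
    τ ∈ transversal f ↔ ∃ φ ∈ labellings f, rep f φ = τ := Finset.mem_image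

theorem comp_mem_labellings (g : Perm (Fin n)) : f ∘ g ∈ labellings f :=
  Finset.mem_image.2 ⟨g, Finset.mem_univ _, rfl⟩

/-- Elements of the transversal with the same labelling coincide. -/
theorem transversal_eq_of_comp_eq {τ τ' : Perm (Fin n)} (hτ : τ ∈ transversal f)
    (hτ' : τ' ∈ transversal f) (h : f ∘ τ = f ∘ τ') : τ = τ' := by
  obtain ⟨φ, hφ, rfl⟩ := (mem_transversal f).1 hτ
  obtain ⟨φ', hφ', rfl⟩ := (mem_transversal f).1 hτ'
  rw [comp_rep f hφ, comp_rep f hφ'] at h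
  rw [h]

/-- `|labellings| · |Y_f| = n!` (the fibres of `g ↦ f ∘ g` are right cosets of `Y_f`). -/
theorem card_labellings_mul_card_young :
    (labellings f).card * (young f).card = n.factorial := by
  classical
  have h := Finset.card_eq_sum_card_fiberwise (f := fun g : Perm (Fin n) => f ∘ (g : Fin n → Fin n))
    (s := Finset.univ) (t := labellings f) (fun g _ => comp_mem_labellings f g)
  rw [Finset.card_univ, Fintype.card_perm, Fintype.card_fin] at h
  rw [h, Finset.sum_const_nat (m := (young f).card) fun φ hφ => ?_]
  -- the fibre over `φ = f ∘ g₀` is the right coset `Y g₀`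
  obtain ⟨g₀, -, rfl⟩ := Finset.mem_image.1 hφ
  refine Finset.card_nbij' (fun g => g * g₀⁻¹) (fun y => y * g₀) ?_ ?_ ?_ ?_
  · intro g hg
    simp only [Finset.coe_filter, Finset.mem_univ, true_and, Set.mem_setOf_eq] at hg
    rw [Finset.mem_coe, mem_young]
    intro x
    have := congrFun hg (g₀⁻¹ x)
    simp only [Function.comp_apply, Perm.coe_inv, Equiv.apply_symm_apply] at this
    rw [Perm.mul_apply, Perm.coe_inv, this]
  · intro y hy
    rw [Finset.mem_coe, mem_young] at hy
    simp only [Finset.coe_filter, Finset.mem_univ, true_and, Set.mem_setOf_eq]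
    funext x
    simp only [Function.comp_apply, Perm.mul_apply, hy]
  · intro g _; simp
  · intro g _; simp

theorem card_transversal_mul_card_young :
    (transversal f).card * (young f).card = n.factorial := by
  rw [card_transversal, card_labellings_mul_card_young]

/-- **Pairwise triple-product relation for `(Y_f, T)`**: `s s'⁻¹ t t'⁻¹ = 1` with `s, s' ∈ Y_f`,
`t, t' ∈ T` forces `s = s'` and `t = t'`. -/
theorem young_transversal_pairwise :
    ∀ s ∈ young f, ∀ s' ∈ young f, ∀ τ ∈ transversal f, ∀ τ' ∈ transversal f,
      s * s'⁻¹ * (τ * τ'⁻¹) = 1 → s = s' ∧ τ = τ' := by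
  intro s hs s' hs' τ hτ τ' hτ' h
  rw [mem_young] at hs hs'
  have hq : τ * τ'⁻¹ = s' * s⁻¹ := by
    have : τ * τ'⁻¹ = (s * s'⁻¹)⁻¹ := eq_inv_of_mul_eq_one_right h
    rw [this, mul_inv_rev, inv_inv]
  have hττ' : τ = τ' := by
    apply transversal_eq_of_comp_eq f hτ hτ'
    have hτeq : τ = s' * s⁻¹ * τ' := by rw [← hq]; simp
    funext x
    rw [Function.comp_apply, Function.comp_apply, hτeq, Perm.mul_apply, Perm.mul_apply, hs']
    have := hs (s⁻¹ (τ' x))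
    simp only [Perm.coe_inv, Equiv.apply_symm_apply] at this
    rw [Perm.coe_inv, this]
  refine ⟨?_, hττ'⟩
  rw [hττ', mul_inv_cancel, mul_one] at h
  exact mul_inv_eq_one.1 h

/-! ### Umvirate counts in `S_n`: see §3 (`card_univ_umvirate_mul_descFactorial`) -/

/-- Permutations sending the sources `I` into prescribed blocks: at most `(∏ₖ b_{βₖ}) · (n-t)!`
of them, i.e. `#{g : f (g (I k)) = β k ∀ k} · n^(t) ≤ (∏ₖ |f⁻¹(β k)|) · n!`. -/
theorem card_comp_blocks_mul_descFactorial_le [Fintype ι] {t : ℕ} (I : Fin t → Fin n)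
    (hI : Function.Injective I) (β : Fin t → ι) :
    ((Finset.univ : Finset (Perm (Fin n))).filter (fun g => ∀ k, f (g (I k)) = β k)).card *
        n.descFactorial t ≤ (∏ k, Fintype.card {x // f x = β k}) * n.factorial := by
  classical
  -- fibre over the embedding `g ∘ I`
  have hfib := Finset.card_eq_sum_card_fiberwise
    (f := fun g : Perm (Fin n) => (⟨g ∘ I, g.injective.comp hI⟩ : Fin t ↪ Fin n))
    (s := (Finset.univ : Finset (Perm (Fin n))).filter (fun g => ∀ k, f (g (I k)) = β k))
    (t := (Finset.univ : Finset (Fin t ↪ Fin n)).filter (fun L' => ∀ k, f (L' k) = β k))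
    (fun g hg => by
      rw [Finset.mem_coe, Finset.mem_filter] at hg ⊢
      exact ⟨Finset.mem_univ _, hg.2⟩)
  -- each fibre is contained in an umvirate `U_{I→L'}`, of size `n!/n^(t)`
  have hle : ((Finset.univ : Finset (Perm (Fin n))).filter (fun g => ∀ k, f (g (I k)) = β k)).card *
      n.descFactorial t ≤
      ((Finset.univ : Finset (Fin t ↪ Fin n)).filter (fun L' => ∀ k, f (L' k) = β k)).card *
        n.factorial := by
    rw [hfib, Finset.sum_mul, ← smul_eq_mul, ← Finset.sum_const]
    refine Finset.sum_le_sum fun L' _ => ?_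
    rw [← card_univ_umvirate_mul_descFactorial I L' hI L'.injective]
    refine Nat.mul_le_mul_right _ (Finset.card_le_card fun g hg => ?_)
    simp only [Finset.mem_filter, Finset.mem_univ, true_and] at hg ⊢
    intro k
    have := congrArg (fun e : Fin t ↪ Fin n => e k) hg.2
    simpa using this
  -- `|E| ≤ ∏ b_{β k}`: `E` injects into `Π k, f⁻¹(β k)`
  have hEle : ((Finset.univ : Finset (Fin t ↪ Fin n)).filter (fun L' => ∀ k, f (L' k) = β k)).card ≤
      ∏ k, Fintype.card {x // f x = β k} := by
    rw [← Fintype.card_pi]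
    let φ : {L' : Fin t ↪ Fin n //
        L' ∈ (Finset.univ : Finset (Fin t ↪ Fin n)).filter (fun L' => ∀ k, f (L' k) = β k)} →
        (∀ k, {x // f x = β k}) :=
      fun L' k => ⟨L'.1 k, by
        have h := L'.2
        simp only [Finset.mem_filter, Finset.mem_univ, true_and] at h
        exact h k⟩
    have hφ : Function.Injective φ := by
      intro a b hab
      apply Subtype.ext
      apply Function.Embedding.ext
      intro k
      have := congrFun hab k
      simpa [φ] using congrArg Subtype.val this
    have := Fintype.card_le_of_injective φ hφ
    rwa [Fintype.card_coe] at this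
  exact hle.trans (Nat.mul_le_mul_right _ hEle)

/-- **Bump bound for the transversal**: `|T ∩ U_{I→L}| · n^(t) ≤ (∏ₖ |block of L k|) · |T|`. -/
theorem transversal_bump [Fintype ι] {t : ℕ} (I L : Fin t → Fin n) (hI : Function.Injective I) :
    ((transversal f).filter (fun g => ∀ k, g (I k) = L k)).card * n.descFactorial t ≤
      (∏ k, Fintype.card {x // f x = f (L k)}) * (transversal f).card := by
  classical
  have hY : 0 < (young f).card := Finset.card_pos.2 ⟨1, by simp [mem_young]⟩
  -- `|T ∩ U| · |Y| ≤ #{g : f (g (I k)) = f (L k)}` via `(τ, y) ↦ y τ`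
  have hinj : ((transversal f).filter (fun g => ∀ k, g (I k) = L k)).card * (young f).card ≤
      ((Finset.univ : Finset (Perm (Fin n))).filter (fun g => ∀ k, f (g (I k)) = f (L k))).card := by
    rw [← Finset.card_product]
    refine Finset.card_le_card_of_injOn (fun p => p.2 * p.1) (fun p hp => ?_) ?_
    · simp only [Finset.coe_product, Finset.coe_filter, Set.mem_prod, Set.mem_setOf_eq,
        Finset.mem_coe, mem_young] at hp
      simp only [Finset.coe_filter, Finset.mem_univ, true_and, Set.mem_setOf_eq]
      intro k
      rw [Perm.mul_apply, hp.1.2 k, hp.2]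
    · intro p hp q hq hpq
      simp only [Finset.coe_product, Finset.coe_filter, Set.mem_prod, Set.mem_setOf_eq,
        Finset.mem_coe, mem_young] at hp hq
      have hpq' : (p.2 : Perm (Fin n)) * p.1 = q.2 * q.1 := hpq
      -- labellings of `p.1` and `q.1` agree, so `p.1 = q.1`
      have h1 : p.1 = q.1 := by
        apply transversal_eq_of_comp_eq f hp.1.1 hq.1.1
        funext x
        have hp2 := hp.2 (p.1 x)
        have hq2 := hq.2 (q.1 x)
        have := congrArg (fun g : Perm (Fin n) => f (g x)) hpq'
        simp only [Perm.mul_apply] at this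
        rw [Function.comp_apply, Function.comp_apply, ← hp2, this, hq2]
      have h2 : p.2 = q.2 := by
        rw [h1] at hpq'
        exact mul_right_cancel hpq'
      exact Prod.ext h1 h2
  have h := card_comp_blocks_mul_descFactorial_le f I hI (fun k => f (L k))
  -- combine: multiply `hinj` by `n^(t)`, use `h`, and `|T||Y| = n!`
  have key : ((transversal f).filter (fun g => ∀ k, g (I k) = L k)).card * n.descFactorial t *
      (young f).card ≤ (∏ k, Fintype.card {x // f x = f (L k)}) * (transversal f).card *
      (young f).card := by
    calc ((transversal f).filter (fun g => ∀ k, g (I k) = L k)).card * n.descFactorial t *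
          (young f).card
        = ((transversal f).filter (fun g => ∀ k, g (I k) = L k)).card * (young f).card *
            n.descFactorial t := by ring
      _ ≤ ((Finset.univ : Finset (Perm (Fin n))).filter
            (fun g => ∀ k, f (g (I k)) = f (L k))).card * n.descFactorial t :=
          Nat.mul_le_mul_right _ hinj
      _ ≤ (∏ k, Fintype.card {x // f x = f (L k)}) * n.factorial := h
      _ = (∏ k, Fintype.card {x // f x = f (L k)}) * (transversal f).card * (young f).card := by
          rw [← card_transversal_mul_card_young f]; ring
  exact Nat.le_of_mul_le_mul_right key hY

end Transversal

/-! ### The hexagon transversal and the pairwise refutation -/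

section HexTransversal

variable (R : ℕ)

/-- The hexagon has at least `(R+1)²` points: `(k, R + l, 2R - k - l)`, `k, l ≤ R`. -/
def HexPt.square (p : Fin (R + 1) × Fin (R + 1)) : HexPt R := by
  refine ⟨![⟨p.1, ?_⟩, ⟨R + p.2, ?_⟩, ⟨2 * R - p.1 - p.2, ?_⟩], ?_⟩
  · have := p.1.isLt; omega
  · have := p.2.isLt; omega
  · omega
  · rw [Fin.sum_univ_three]
    simp only [Matrix.cons_val_zero, Matrix.cons_val_one, Matrix.cons_val]
    have h1 := p.1.isLt; have h2 := p.2.isLt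
    omega

theorem HexPt.square_injective : Function.Injective (HexPt.square R) := by
  intro p q h
  have h0 := congrArg (fun v : HexPt R => (v.1 0 : ℕ)) h
  have h1 := congrArg (fun v : HexPt R => (v.1 1 : ℕ)) h
  simp only [HexPt.square, Matrix.cons_val_zero, Matrix.cons_val_one] at h0 h1
  exact Prod.ext (Fin.ext (by simpa using h0)) (Fin.ext (by omega))

theorem sq_le_hexN : (R + 1) ^ 2 ≤ hexN R := by
  have h := Fintype.card_le_of_injective _ (HexPt.square_injective R)
  simpa [hexN, sq, Fintype.card_prod, Fintype.card_fin] using h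

/-- Every line of the hexagon has at most `2R+1` points (a second coordinate determines the
point on the line). -/
theorem HexPt.card_line_le (j : Fin 3) (i : Fin (2 * R + 1)) :
    Fintype.card {p : HexPt R // p.1 j = i} ≤ 2 * R + 1 := by
  have h0 : Fintype.card {p : HexPt R // p.1 0 = i} ≤ 2 * R + 1 := by
    have h := Fintype.card_le_of_injective (fun p : {p : HexPt R // p.1 0 = i} => p.1.1 1)
      (fun p q hpq => Subtype.ext (HexPt.ext01 (p.2.trans q.2.symm) hpq))
    simpa using h
  refine le_trans (le_of_eq (Fintype.card_congr ?_)) h0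
  refine ((HexPt.perm (Equiv.swap 0 j)).subtypeEquiv fun p => ?_).symm
  simp [HexPt.perm]

theorem card_block_hexLabel_le (j : Fin 3) (i : Fin (2 * R + 1)) :
    Fintype.card {x // hexLabel R j x = i} ≤ 2 * R + 1 := by
  refine le_trans (le_of_eq (Fintype.card_congr ?_)) (HexPt.card_line_le R j i)
  exact (hexEquiv R).subtypeEquiv fun x => Iff.rfl

/-- The right transversal of the first hexagon Young subgroup. -/
def hexTrans : Finset (Perm (Fin (hexN R))) := transversal (hexLabel R 0)

theorem card_hexYoung_mul_card_hexTrans :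
    (hexYoung R 0).card * (hexTrans R).card = (hexN R).factorial := by
  rw [mul_comm]; exact card_transversal_mul_card_young (hexLabel R 0)

/-- **The hexagon transversal is `(1/2+ε)`-bump-free at every level** once `n^ε ≥ 2`:
its umvirate ratios are at most `(2R+1)^t ≤ (2√n)^t`. -/
theorem hexTrans_bump {ε : ℝ} (hε : 2 ≤ (hexN R : ℝ) ^ ε) {t : ℕ}
    (I L : Fin t → Fin (hexN R)) (hI : Function.Injective I) :
    (((hexTrans R).filter (fun g => ∀ k, g (I k) = L k)).card : ℝ) *
        ((hexN R).descFactorial t : ℝ) ≤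
      ((hexN R : ℕ) : ℝ) ^ ((1 / 2 + ε) * t) * (hexTrans R).card := by
  have hn0 : (0 : ℝ) < (hexN R : ℝ) := Nat.cast_pos.2 (hexN_pos R)
  have hnat := transversal_bump (hexLabel R 0) I L hI
  have hprod : (∏ k, Fintype.card {x // hexLabel R 0 x = hexLabel R 0 (L k)}) ≤ (2 * R + 1) ^ t := by
    calc (∏ k, Fintype.card {x // hexLabel R 0 x = hexLabel R 0 (L k)})
        ≤ ∏ _k : Fin t, (2 * R + 1) := Finset.prod_le_prod' fun k _ => card_block_hexLabel_le R 0 _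
      _ = (2 * R + 1) ^ t := by simp
  have h1 : (((hexTrans R).filter (fun g => ∀ k, g (I k) = L k)).card : ℝ) *
      ((hexN R).descFactorial t : ℝ) ≤ ((2 * R + 1 : ℕ) : ℝ) ^ t * (hexTrans R).card := by
    have := hnat.trans (Nat.mul_le_mul_right _ hprod)
    exact_mod_cast this
  refine h1.trans (mul_le_mul_of_nonneg_right ?_ (Nat.cast_nonneg _))
  -- `2R+1 ≤ 2(R+1) ≤ 2√n ≤ n^ε √n = n^{1/2+ε}`
  rw [Real.rpow_mul_natCast hn0.le]
  refine pow_le_pow_left₀ (Nat.cast_nonneg _) ?_ t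
  have hsq : ((R + 1 : ℕ) : ℝ) ≤ Real.sqrt (hexN R : ℝ) := by
    rw [Real.le_sqrt (Nat.cast_nonneg _) hn0.le]
    exact_mod_cast sq_le_hexN R
  rw [Real.rpow_add hn0, ← Real.sqrt_eq_rpow]
  calc ((2 * R + 1 : ℕ) : ℝ) ≤ 2 * ((R + 1 : ℕ) : ℝ) := by push_cast; linarith
    _ ≤ 2 * Real.sqrt (hexN R : ℝ) := by linarith
    _ ≤ (hexN R : ℝ) ^ ε * Real.sqrt (hexN R : ℝ) :=
        mul_le_mul_of_nonneg_right hε (Real.sqrt_nonneg _)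
    _ = Real.sqrt (hexN R : ℝ) * (hexN R : ℝ) ^ ε := mul_comm _ _

end HexTransversal

/-- The PAIRWISE (two-set) version of the crux: if `(S, T)` has the two-set triple-product
relation and both sets are `(1/2+ε)`-bump-free up to level `√n`, then `|S||T| ≤ n!·e^{-c√n}`. -/
def PairwiseGlobalBranch : Prop :=
  ∃ ε : ℝ, 0 < ε ∧ ∃ c : ℝ, 0 < c ∧ ∃ n₀ : ℕ, ∀ n ≥ n₀, ∀ S T : Finset (Equiv.Perm (Fin n)),
    (∀ s ∈ S, ∀ s' ∈ S, ∀ t ∈ T, ∀ t' ∈ T, s * s'⁻¹ * (t * t'⁻¹) = 1 → s = s' ∧ t = t') →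
    (∀ X : Finset (Equiv.Perm (Fin n)), (X = S ∨ X = T) → ∀ t : ℕ, 1 ≤ t →
      (t : ℝ) ≤ Real.sqrt (n : ℝ) → ∀ I L : Fin t → Fin n, Function.Injective I →
      Function.Injective L →
        ((X.filter (fun σ => ∀ k, σ (I k) = L k)).card : ℝ) * (n.descFactorial t : ℝ) ≤
          (n : ℝ) ^ ((1 / 2 + ε) * t) * (X.card : ℝ)) →
    ((S.card * T.card : ℕ) : ℝ) ≤ (n.factorial : ℝ) * Real.exp (-(c * Real.sqrt (n : ℝ)))

/-- Real arithmetic of the three pairwise bounds: `ab, bc, ca ≤ F·E` with `0 < E ≤ 1` give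
`abc ≤ F^{3/2}·E`. -/
theorem mul_three_le_of_pairs {a b c F E : ℝ} (ha : 0 ≤ a) (hb : 0 ≤ b) (hc : 0 ≤ c)
    (hF : 0 < F) (hE0 : 0 < E) (hE1 : E ≤ 1) (hab : a * b ≤ F * E) (hbc : b * c ≤ F * E)
    (hca : c * a ≤ F * E) : a * b * c ≤ F ^ ((3 : ℝ) / 2) * E := by
  have hFE : 0 < F * E := mul_pos hF hE0
  have hsq : (a * b * c) ^ 2 ≤ (F * E) ^ 3 := by
    calc (a * b * c) ^ 2 = (a * b) * (b * c) * (c * a) := by ring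
      _ ≤ (F * E) * (F * E) * (F * E) := by
          apply mul_le_mul (mul_le_mul hab hbc (by positivity) (by positivity)) hca
            (by positivity) (by positivity)
      _ = (F * E) ^ 3 := by ring
  have hV0 : 0 ≤ a * b * c := by positivity
  have hV' : a * b * c ≤ (F * E) ^ ((3 : ℝ) / 2) := by
    have h := Real.rpow_le_rpow (by positivity : (0 : ℝ) ≤ (a * b * c) ^ 2) hsq
      (by norm_num : (0 : ℝ) ≤ 1 / 2)
    have e1 : ((a * b * c) ^ 2) ^ ((1 : ℝ) / 2) = a * b * c := by
      rw [← Real.sqrt_eq_rpow, Real.sqrt_sq hV0]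
    have e2 : ((F * E) ^ 3) ^ ((1 : ℝ) / 2) = (F * E) ^ ((3 : ℝ) / 2) := by
      rw [show ((F * E) ^ 3) = (F * E) ^ ((3 : ℕ) : ℝ) by rw [Real.rpow_natCast],
        ← Real.rpow_mul hFE.le]
      norm_num
    rwa [e1, e2] at h
  refine hV'.trans ?_
  rw [Real.mul_rpow hF.le hE0.le]
  refine mul_le_mul_of_nonneg_left ?_ (by positivity)
  calc E ^ ((3 : ℝ) / 2) ≤ E ^ (1 : ℝ) :=
        Real.rpow_le_rpow_of_exponent_ge hE0 hE1 (by norm_num)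
    _ = E := Real.rpow_one E

/-- **The pairwise version IMPLIES the crux** (so it is a genuine strengthening; stated
contrapositively, as a negative-side lemma): under the TPP all three pairs `(S,T), (T,U), (U,S)`
satisfy the two-set relation (rotation, and a repeated third element), and the three pairwise
bounds multiply to `(|S||T||U|)² ≤ (n!)³ e^{-3c√n}`. -/
theorem not_pairwiseGlobalBranch_of_not_globalBranch
    (hG : ¬ Summit.MatrixMultiplication.MatrixMultiplication.Theses.SnSubsetDichotomy.GlobalBranch) :
    ¬ PairwiseGlobalBranch := by
  rintro ⟨ε, hε, c, hc, n₀, H⟩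
  refine hG ⟨ε, hε, c, hc, n₀, fun n hn S T U hTPP hB => ?_⟩
  -- empty set: volume `0`
  by_cases hne : S.Nonempty ∧ T.Nonempty ∧ U.Nonempty
  swap
  · have h0 : S.card * T.card * U.card = 0 := by
      simp only [not_and_or, Finset.not_nonempty_iff_eq_empty] at hne
      rcases hne with h | h | h <;> simp only [h, Finset.card_empty, zero_mul, mul_zero]
    rw [h0]; push_cast; positivity
  obtain ⟨⟨s₀, hs₀⟩, ⟨t₀, ht₀⟩, ⟨u₀, hu₀⟩⟩ := hne
  -- rotation of the triple product property
  have rot : ∀ {A B C : Finset (Equiv.Perm (Fin n))}, TripleProductProperty A B C →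
      TripleProductProperty B C A := by
    intro A B C h b hb b' hb' c' hc' c'' hc'' a ha a' ha' heq
    have heq' : a * a'⁻¹ * (b * b'⁻¹) * (c' * c''⁻¹) = 1 :=
      calc a * a'⁻¹ * (b * b'⁻¹) * (c' * c''⁻¹)
          = a * a'⁻¹ * (b * b'⁻¹ * (c' * c''⁻¹) * (a * a'⁻¹)) * (a * a'⁻¹)⁻¹ := by group
        _ = 1 := by rw [heq]; group
    obtain ⟨h1, h2, h3⟩ := h a ha a' ha' b hb b' hb' c' hc' c'' hc'' heq'
    exact ⟨h2, h3, h1⟩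
  -- the two-set relation for a pair follows from the TPP with a repeated third element
  have pair : ∀ {A B C : Finset (Equiv.Perm (Fin n))}, TripleProductProperty A B C →
      ∀ c₀ ∈ C, ∀ a ∈ A, ∀ a' ∈ A, ∀ b ∈ B, ∀ b' ∈ B,
        a * a'⁻¹ * (b * b'⁻¹) = 1 → a = a' ∧ b = b' := by
    intro A B C h c₀ hc₀ a ha a' ha' b hb b' hb' he
    have := h a ha a' ha' b hb b' hb' c₀ hc₀ c₀ hc₀ (by rw [he, mul_inv_cancel, one_mul])
    exact ⟨this.1, this.2.1⟩
  have bST := H n hn S T (pair hTPP u₀ hu₀) (fun X hX => hB X (by tauto))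
  have bTU := H n hn T U (pair (rot hTPP) s₀ hs₀) (fun X hX => hB X (by tauto))
  have bUS := H n hn U S (pair (rot (rot hTPP)) t₀ ht₀) (fun X hX => hB X (by tauto))
  have hE1 : Real.exp (-(c * Real.sqrt (n : ℝ))) ≤ 1 := by
    rw [Real.exp_le_one_iff, neg_nonpos]; positivity
  have hF0 : (0 : ℝ) < (n.factorial : ℝ) := by exact_mod_cast n.factorial_pos
  have bST' : (S.card : ℝ) * (T.card : ℝ) ≤ (n.factorial : ℝ) * Real.exp (-(c * Real.sqrt (n : ℝ))) := by
    exact_mod_cast bST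
  have bTU' : (T.card : ℝ) * (U.card : ℝ) ≤ (n.factorial : ℝ) * Real.exp (-(c * Real.sqrt (n : ℝ))) := by
    exact_mod_cast bTU
  have bUS' : (U.card : ℝ) * (S.card : ℝ) ≤ (n.factorial : ℝ) * Real.exp (-(c * Real.sqrt (n : ℝ))) := by
    exact_mod_cast bUS
  have key := mul_three_le_of_pairs (Nat.cast_nonneg S.card) (Nat.cast_nonneg T.card)
    (Nat.cast_nonneg U.card) hF0 (Real.exp_pos _) hE1 bST' bTU' bUS'
  exact_mod_cast key

/-- **The pairwise strengthening is FALSE**: `(Y, T)` = (hexagon Young subgroup, its right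
transversal) satisfies the two-set relation, both sets are `(1/2+ε)`-bump-free at every level
once `n^ε ≥ 2e`, and `|Y||T| = n!` exactly.  So packing/two-set arguments give no saving at all
for bump-free sets: the `e^{-c√n}` of the crux must come from the genuinely 3-wise relation. -/
theorem not_pairwiseGlobalBranch : ¬ PairwiseGlobalBranch := by
  rintro ⟨ε, hε, c, hc, n₀, H⟩
  set R : ℕ := max n₀ ⌈(2 * Real.exp 1) ^ (1 / ε)⌉₊ with hR
  have hn : hexN R ≥ n₀ :=
    le_trans (le_max_left _ _) ((Nat.le_succ R).trans (succ_le_hexN R))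
  have hεn : 2 * Real.exp 1 ≤ (hexN R : ℝ) ^ ε := by
    have h1 : (2 * Real.exp 1) ^ (1 / ε) ≤ (hexN R : ℝ) := by
      calc (2 * Real.exp 1) ^ (1 / ε) ≤ ⌈(2 * Real.exp 1) ^ (1 / ε)⌉₊ := Nat.le_ceil _
        _ ≤ (R : ℝ) := by exact_mod_cast le_max_right _ _
        _ ≤ (hexN R : ℝ) := by exact_mod_cast (Nat.le_succ R).trans (succ_le_hexN R)
    have h2 := Real.rpow_le_rpow (by positivity) h1 hε.le
    rwa [← Real.rpow_mul (by positivity), one_div_mul_cancel hε.ne', Real.rpow_one] at h2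
  have hεn2 : 2 ≤ (hexN R : ℝ) ^ ε := by
    refine le_trans ?_ hεn
    have := Real.add_one_le_exp (1 : ℝ)
    linarith
  have key := H (hexN R) hn (hexYoung R 0) (hexTrans R) (young_transversal_pairwise (hexLabel R 0)) ?_
  · -- `|Y||T| = n! > n! e^{-c√n}`
    rw [card_hexYoung_mul_card_hexTrans R] at key
    have hF0 : (0 : ℝ) < ((hexN R).factorial : ℝ) := by exact_mod_cast (hexN R).factorial_pos
    have hlt : Real.exp (-(c * Real.sqrt (hexN R : ℝ))) < 1 := by
      rw [Real.exp_lt_one_iff, neg_lt_zero]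
      exact mul_pos hc (Real.sqrt_pos.2 (Nat.cast_pos.2 (hexN_pos R)))
    have := mul_lt_mul_of_pos_left hlt hF0
    rw [mul_one] at this
    linarith
  · rintro X hX t - - I L hI -
    rcases hX with rfl | rfl
    · exact hexYoung_bump R 0 hεn I L hI
    · exact hexTrans_bump R hεn2 I L hI


end Summit.MatrixMultiplication.MatrixMultiplication.Cruxes.GlobalBranch.Disproof
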